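import Literature.MathematicalPhysics.QuantumFieldTheory.Balaban1983to89.T4RelativeComb

/-!
# `Balaban1983to89.T4RelativeCombGradient` — FIRST LATTICE DIFFERENCES of the transverse comb defect of a pair of
# NON-ABELIAN configurations on a block of `ℤ^d`: LOCAL along tree directions, a PARALLEL-LADDER recursion across,
# the derivative input it consumes, and the (sup, difference) ↦ Hölder interpolation

CITATION HEADER (lean-in-tree rule 2026-08-18).  Kernel certificate, on the CONCRETE `ℤ^d` model of the tree module
`T4RelativeComb` (relative staircase-comb gauge `g = combGauge U₀ U₁ z` of a pair of unit-valued configurations on the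
block `B(z) = z + {0,…,L−1}^d`, transverse defect `W = (U₁^g)·U₀⁻¹`), of the elementary first-DIFFERENCE bookkeeping
that the cell's located record (O2a) «Hölder / first-derivative norms of the comb defect» asks for (cell record
`t4/T4-EST-NE1p-P1.md` §4 (O2)/(O2)′, GAPS G-ne1p1-1, G-ne1p1-3; carved row T4-O3.E-NE1′-OG1′-RESID° part (ii) of
`t4/T4-DAG.md` v17).  The manuscripts whose sentences are CONTEXT here are under ADJUDICATION by the cell
`pub-balaban` and NOTHING printed in them enters this file as a hypothesis or is asserted: T. Bałaban, *Spaces of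
regular gauge field configurations on a lattice and gauge fixing conditions*, Comm. Math. Phys. **99**, 75–102 (1985)
[Balaban1985RegularSpaces] (cell paper B8) — p. 79 Lemma 1 (1.24)–(1.26) and its proof, p. 82 (1.36)–(1.38), p. 83
(1.39) and Theorem 2 (renders READ by this unit: `HOME/b2b-balaban-ref1/pages/1985-cmp99-regular-spaces-gauge-fixing/
…-p005-x2.png`, `…-p008-x2.png`, `…-p009-x2.png`; journal page = PDF page + 74); T. Bałaban, *Renormalization group
approach to lattice gauge field theories. I*, Comm. Math. Phys. **109**, 249–301 (1987) [Balaban1987RG1] (cell paper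
B12) — p. 277 (3.32), (3.37) (render READ: `…/1987-cmp109-rg-I-small-field/…-p029-x2.png`; journal page = PDF page +
248) and p. 276 (3.30)/(3.31) (quotation COPIED from the certified citation header of the tree module
`T4BirthChartTransport` v1.1, which names its render p028; labelled COPY below); T. Bałaban, *Averaging operations for
lattice gauge theories*, Comm. Math. Phys. **98**, 17–51 (1985) [Balaban1985Averaging] (B7) pp. 24–25 (44)–(47)
(quotation COPIED from the certified headers of `T4AxialChain` / `T4RelativeComb`).

PRINTED ([Balaban1985RegularSpaces] p. 79, READ): "Lemma 1. Let V₀, V′V₀ satisfy the condition (1.7) for k = 1 and L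
arbitrary, and let (R(V₀)V′)(Γ_{y,x}) = 1 for x ∈ B(y), |V′V₀‾ − V̄₀| < α₁ on Ω₁^{(1)}. (1.24) Then for α₀, α₁ small
the configuration V′ is also small, more precisely we have the bound |V′ − 1| < 4d²α₀ + α₁ on Ω₁. (1.25)"; proof:
"From (1.22) and the assumptions we have |(∂_{V₀}V′)(p) − 1| ≦ |V₀(∂p) − 1| + |(V′V₀)(∂p) − 1| < 2α₀L⁻². (1.26) The
conditions (R₀V′)(Γ_{y,x}) = 1, x ∈ B(y), imply V′_b = 1 for b ⊂ Γ_{y,x}. This and the above estimate imply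
|V′_b − 1| < (d − 1)(L − 1)2α₀L⁻² for b ⊂ B(y) by the same reasoning as in [3] (between (44) and (46)). For a
plaquette p connecting two neighboring blocks B(c₋), B(c₊) we take two bonds b′, b″ ⊂ ∂p, b′, b″ ∈ B(c) and from
(1.26) and the bounds on |V′_b − 1| for b′, b″ belonging either to B(c₋), or to B(c₊), we get
|R(V₀(b′₋, b″₋))V′_{b″} − V′_{b′}| < 2α₀L⁻² + 4(d − 1)α₀L⁻¹ < 4dα₀L⁻¹."  — the LAST sentence is the only printed
FIRST-DIFFERENCE statement about the axial-gauge `V′` the unit found: a covariant difference of `V′` across ONE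
plaquette bounded by (plaquette deviation) + (the two SUP bounds), i.e. the CRUDE estimate `|∇V′| ≲ 2·sup|V′ − 1| +
curvature`; no sharper gradient or Hölder statement for the axial gauge is printed there ((44)–(47) of
[Balaban1985Averaging] pp. 24–25, COPIED context: "The conditions V₀(Γ_{y,x}) = 1 imply V₀(x, x + e₁) = 1,
|V₀(x, x + e₂) − 1| < |x₁ − y₁|α₀, …" — SUP bounds only).
PRINTED ([Balaban1985RegularSpaces] p. 82, READ — the REGULAR (Landau) gauge, where derivative norms ARE printed):
"Now our problem is to construct a gauge transformation u satisfying the equalities (1.29) and such that U₁ = U′^{u⁻¹}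
satisfies the conditions U₁ = e^{iηA}, |A| < B₁(α₀ + α₁)(L^jη)^{−1}, |∇^η_{U₀}A| < B₁(α₀ + α₁)(L^jη)^{−2},
‖A‖_{1,β} < B₂(β₀)(α₀ + α₁)(L^jη)^{−2−β}, β ≦ β₀ < 1, on Ω_j, j = 0, 1, …, k, (1.36) … |B| < 2dLα₁ by the assumption
(1.35), (1.37) R(U₀)D^{η*}_{U₀}A = 0. (1.38)"; p. 83 (READ): "Thus (1.36) contains all the results we have to prove
about A, besides its existence. This condition describes fully regularity properties of the first order derivatives.
Such information is unavailable for the second order derivatives, but we have the following bounds for the second order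
operators acting on A: |D^{η*}_{U₀}D^η_{U₀}A|, |Δ^η_{U₀}A| < B₁(α₀ + α₁)(L^jη)^{−3} on Ω_j, j = 0, 1, …, k. (1.39)"
and "Theorem 2. There exist constants B₁, B₂(β₀), c₁ such that for arbitrary U₀, U′U₀ satisfying (1.33)–(1.35) with
α₀ + α₁ ≦ c₁ there exists exactly one gauge transformation u satisfying (1.29) and such that the conditions
(1.36)–(1.39) hold for the configuration U₁ = U′^{u⁻¹}." (tree: `B8.Thm2Printed`, `B8.GFData.C136/Landau`).
PRINTED ([Balaban1987RG1] p. 276, COPY of the certified quotation in `T4BirthChartTransport`): "(3.31) |𝐀|, |∇^η𝐀|,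
‖𝐀‖_{1,β} < α₂ on □₀"; p. 277 (READ): "The assumption (3.31) implies that A satisfies |A|, |∇^ηA|, ‖A‖_{1,β} <
2(α₂ + B₃O(1)Mα₀) on □̃⁴. (3.32) These regularity conditions are basic for the further analysis." and "(3.37) …
|u_j − 1| < B₃²O(1)Mα₀."

READING — THE MODEL (the cell's, inherited verbatim from `T4RelativeComb`; not the papers' words).  `U x ν ∈ Rˣ`
(units of a normed ring, `NormOneClass`), "G-valued" = `T4RelativeLadder.UnitaryLike`, the gauge action `gaugeAct`,
based plaquettes `plaq`, the block `InBlock L z`, offsets `site z k`, the relative comb gauge `combGauge U₀ U₁ z`, the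
defect `defect U₀ U₁ z x ν = (U₁^g) x ν · (U₀ x ν)⁻¹`, the ladder length `ladderLen k ν = Σ_{ρ<ν} k ρ ≤ C :=
(d−1)(L−1)`, and the GAUGE-FIXED per-square deviation field `E(y;ρ,ν) = plaq(U₁^g)(y;ρ,ν) − plaq U₀(y;ρ,ν)` with
sup `s` (`PlaqSup`).  A "first lattice difference in direction μ" of the defect is the PLAIN difference
`W⟨x+e_μ, ·+e_ν⟩ − W⟨x, ·+e_ν⟩` of ring elements (no logarithm, no `η`-quotient, no covariantisation: in the comb
gauge the tree bonds are `= U₀`-matched and the plain difference is the natural bookkeeping object; a covariant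
version differs by conjugations with `U₀`-bond variables, `‖U₀ − 1‖ ≤ τ`, i.e. by `O(τ·‖W − 1‖)` — not typed).

WHAT THE TREE ALREADY HAS.  `T4RelativeComb` (pv04-g13): the model, `defect_tree` (`W = 1` on tree bonds),
the relative Stokes square `defect_rung`, the MASTER SUP COUNT `norm_defect_sub_one_le_ladderLen : ‖W − 1‖ ≤
ladderLen·s ≤ C·s`.  `T4RelativeLadder` (t4-ne1p-p1, v4 §5–§9): on the abstract `ℕ`-indexed ladder, first and second
differences ALONG a tooth (`norm_defect_succ_sub_defect_le`, `ladderMap`, `norm_ladderMap_sub_ladderMap_le`,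
`norm_defect_second_diff_le`) and the two-ladder covariant recursion ACROSS (`covDiff`, `norm_covDiff_le`) with the
covariant difference of the deviations as a declared INPUT — its header: "WHAT STAYS OPEN … the second differences
ACROSS teeth … the d-dimensional block-wise … choice of combs".  `T4RelativeCombWindow` / `T4RelativeCombCrossing`
(pv04-g14): parts (i)/(iii) of the same carved row (response to a moved base; crossing bonds) — SUP norm.
`T4BlockTransport` (t4-ne1p-p1-g3): the consumer seam `latN` = a SUP bound, header "no Hölder/derivative window norms
(O2a)".

WHAT THIS FILE ADDS (kernel-checked; NEW sibling leaf, imports `T4RelativeComb` BY NAME, nothing above is edited;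
every theorem [folklore] or [arith]; the `d`-dimensional lattice version of `T4RelativeLadder` §5–§6 for FIRST
differences, on the concrete comb).
§0 Generic one-square bounds for the linear ladder map `F(X) = hb⁻¹(P₁·X·P₀⁻¹)hb` of `T4RelativeLadder`
   (`norm_ladderMap_le`, `norm_ladderMap_one_sub_one_le`, `norm_ladderMap_sub_le : ‖F X − X‖ ≤ ‖P₁ − P₀‖ +
   ‖X − 1‖(‖P₁ − 1‖ + ‖P₀ − 1‖ + 2‖hb − 1‖)`, `norm_ladderMap_pair_sub_le`: two ladder maps with different data
   applied to two arguments — first order in the data differences).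
§1 Offset geometry: tree-likeness and `low`/`pred'` under `k ↦ k + e_μ` (`isTree_add_single_self`,
   `low_add_single_of_lt`, `pred'_add_single_of_lt`, …), the CROSS LENGTH `crossLen k μ ν = Σ_{ρ<μ, ρ<ν} k ρ ≤
   ladderLen k ν` (the number of parallel-ladder steps a `μ`-difference at height `ν` needs), `crossLen_eq_succ`,
   `low_lt_of_crossLen_ne_zero`.
§2 ALONG (the offset `k` tree-like below `μ`): the rung AS a ladder map (`defect_rung_eq_ladderMap`, from
   `T4RelativeComb.defect_rung`), hence `‖W(z+k+e_{ρ₀}) − W(z+k′)‖`-type one-rung differences are LOCAL: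
   `norm_defect_rung_sub_defect_le` (exact one-square form) and `_of_sup : ≤ s + ladderLen·s·(2q₀ + s + 2τ)`;
   packaged for `μ < ν`: `norm_gradient_treeDir_le : ‖W⟨z+k+e_μ,·+e_ν⟩ − W⟨z+k,·+e_ν⟩‖ ≤ s + ladderLen·s·(2q₀ + s +
   2τ)` — FIRST order in `s` with an `O(C·s·(q₀+s+τ))` correction, versus the crude `2·C·s`; and for `μ ≥ ν` at an
   offset tree-like below `ν` the difference VANISHES (`gradient_eq_zero_of_isTree`; both bonds are tree bonds).
§3 ACROSS (some coordinate below `min(μ,ν)` non-zero): ONE PARALLEL-LADDER STEP `norm_transverse_step_le` — the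
   `μ`-difference at `z+k` equals the ladder map applied to the `μ`-difference one rung lower PLUS a source that is
   first order in the plain `μ`-differences of the square's data: `‖U₀(y+e_μ)ρ₀ − U₀(y)ρ₀‖` (base bond gradient, ×
   smallness), `‖E(y+e_μ) − E(y)‖` (the DEVIATION-FIELD GRADIENT — coefficient ONE), `‖plaq U₀(y+e_μ) − plaq U₀(y)‖`
   (base curvature gradient, × smallness); UNROLLED by induction on `crossLen` down to the LOCAL foot of §2:
   `norm_transverse_diff_le`, and in site form on interior bonds `norm_gradient_le : ‖W⟨x+e_μ,·+e_ν⟩ − W⟨x,·+e_ν⟩‖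
   ≤ s·(1 + C(2q₀ + s + 2τ)) + C·(2γU(Cs + s) + γE + γP(2Cs + s))`, `C = (d−1)(L−1)`, under block-sup HYPOTHESES
   `s` (gauge-fixed deviation), `q₀` (base curvature), `τ` (base bonds), `γU, γP, γE` (plain `μ`-gradients of base
   bonds, base plaquettes, deviation field).  READING: the first difference of the comb defect is `s + C·γE` up to
   cross terms — LOCAL (order `s`, not `C·s`) exactly when the deviation field varies slowly across the block
   (`γE ≪ s`), which is the FORMAT of a window whose gradient entry is as small as its amplitude entry in lattice
   units ((3.31)/(1.36): `|∇^η·|` carries one more power of `(L^jη)^{−1}`, i.e. the plain one-bond difference is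
   `η`-suppressed); with only sup data (`γE ≤ 2s`) the bound degenerates to the crude `O(C·s)` of the printed p. 79
   sentence.  NO bound for a transverse difference in terms of `s, q₀, τ` alone is asserted or true in the model (an
   additive `d = 2` witness: `θ(x;1) = c·x₀·x₁`, `θ(x;0) = 0` is in tree gauge, its plaquettes near the face `x₁ = 0`
   are `O(c)`-small while the `μ = 1` difference of the bond variable at `x` is `c·x₀ = ladderLen × (plaquette
   gradient)` — prose only, NOT typed here).
§4 [arith] Lattice Hölder interpolation along a path (`min_le_rpow_mul_rpow`, `norm_sub_le_holder : ‖f(x+m) − f(x)‖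
   ≤ (2A)^{1−β}B^β m^β` from `‖f‖ ≤ A`, `‖Δf‖ ≤ B`): how a `β`-quotient is read off (sup, first difference) on a
   lattice — for `W − 1` this gives the `C^{0,β}` quotient from `T4RelativeComb` + §2–§3; the `C^{1,β}` quotient of
   the printed `‖·‖_{1,β}` needs SECOND differences in all direction pairs (along a tooth: `T4RelativeLadder` §9;
   across: NOT in the tree).
§5 Non-vacuity (`combGauge_self`; the flat pair inhabits every hypothesis of `norm_gradient_le` with all constants `0`
   and the bound is `0`).
§6 (v1.1, APPEND-ONLY) THE INPUT `γE` DISCHARGED FROM RAW DATA: the RE-COMBING IDENTITY `g(x+e_μ) = U₀⁻¹·W⁻¹·g(x)·U₁`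
   across any bond (`combGauge_step` — the definition of the defect rearranged), hence `‖g(x+e_μ) − g(x)‖ ≤ τ₀ +
   ‖W⟨x,x+e_μ⟩ − 1‖ + τ₁ ≤ τ₀ + C·s + τ₁` (`norm_combGauge_step_sub_le` + the master sup count), and
   `‖E(y+e_μ) − E(y)‖ ≤ γ₁ + γ₀ + 2‖plaq U₁(y) − 1‖·‖g(y+e_μ) − g(y)‖` (`norm_conjDev_sub_conjDev_le`): the `hγE`
   hypothesis holds with `γE := γ₁ + γ₀ + 2q₁(τ₀ + C·s + τ₁)` from block sups of the RAW plaquette gradients `γ₁, γ₀`,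
   the raw curvature `q₁`, the bond deviations `τ₀, τ₁` and `s` (`deviation_gradient_le`); plugged into §3:
   `norm_gradient_le_raw`.  This CORRECTS the cell record G-pv24g10-1 (R1) ("not bookkeeping"): it is; what it does NOT
   give is any regime statement (whether `γ₁ + γ₀ + 2q₁(τ₀ + C·s + τ₁)` is small against `s` is data, not algebra).

HONEST SCOPE / NOT TYPED.  (i) ONE BLOCK, ONE comb (corner-anchored, `d`-first staircase of `B8Lemma1Lattice`); no
patching across blocks / `M`-cubes (O2b), no crossing bonds (part (iii), `T4RelativeCombCrossing`), no moved base
(part (i), `T4RelativeCombWindow`).  (ii) PLAIN first differences of the unit-valued defect only: no logarithm, no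
Lie-algebra field `A = (1/iη) log W`, no `η`-difference quotients or powers of `L^jη`, no covariant derivative
`∇^η_{U₀}` in Bałaban's sense (see READING), no second differences across teeth, no `‖·‖_{1,β}` norm of a field on a
block is DEFINED here — §4 is the generic path interpolation only.  (iii) `UnitaryLike` pairs only; for COMPLEX
(Gᶜ-valued) pairs every conjugation step acquires `‖u‖‖u⁻¹‖` factors (as in `T4RelativeComb` scope (ii)) — not
covered.  (iv) Every input (`s, q₀, τ, γU, γP, γE`) is a HYPOTHESIS in block-sup form; which of them Bałaban's spaces
(1.33)–(1.35) / (3.31) supply, and with which powers of `L^jη`, is NOT asserted — in particular `γE` (the plain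
gradient of the GAUGE-FIXED deviation field) is the typed form of the cell's missing input (O2c) "incl. gradients" and
is NOT discharged from raw (un-gauge-fixed) data here (`T4RelativeComb.plaqSup_fine` discharges only its SUP `s`).
[v1.1: §6 DOES discharge `γE`, by `γ₁ + γ₀ + 2q₁(τ₀ + C·s + τ₁)` from block sups of RAW plaquette gradients, raw
curvature and bond deviations (`deviation_gradient_le`, `norm_gradient_le_raw`); the inputs `γ₀, γ₁, q₁, τ₀, τ₁`
remain HYPOTHESES in block-sup form and (iv)'s disclaimer about Bałaban's spaces and `L^jη`-powers applies to them.]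
(v) CONSUMER SEAM, honestly: `T4BlockTransport.latN` / `block_transport` consume a SUP bound only; a first-difference
window enters the T4 chain, if at all, through the abstract direction-norm slot `N : Dir → ℝ` of
`T4BirthChartTransport.BirthSlice` / `transport_of_birthChart`, whose instantiation by a `C¹`-type norm is NOT done
here or anywhere in the tree.  (vi) LOCATION of print vs. NEW: derivative / Hölder window norms are PRINTED only for
the REGULAR (Landau) gauge field `A` of [Balaban1985RegularSpaces] Theorem 2 (1.36)–(1.39) (tree `B8.Thm2Printed`,
whose uniqueness clause rests on Prop. 5 with the cell's GAPS G-B8-05) and, as an inductive ASSUMPTION/conclusion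
pair, in [Balaban1987RG1] (3.31)/(3.32); for the AXIAL (comb) gauge the print is SUP-norm plus the crude one-plaquette
difference sentence of p. 79 quoted above.  §2–§3 (local tree-direction differences; the parallel-ladder recursion
with the deviation-gradient source; the unrolled first-order bound) are therefore the CELL's elementary bookkeeping,
[folklore], not a transcription of a printed estimate, and NOT a substitute for Theorem 2.  (vii) NO statement about
Bałaban's renormalization transformations, the spaces 𝔄_k / 𝔘ᶜ_j, the windows, or UV stability is asserted; value =
kernel bookkeeping of finite group identities and triangle inequalities on concrete carriers + a located-gap narrowing
(the first-difference layer of (O2a) on one block, with its load-bearing missing input `γE` = (O2c) named and placed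
— and, v1.1 §6, reduced to raw first-order block sups), NOT summit progress.  Unit `b2b-balaban-pv24` gen 10 (journal
claim T4-O3.E-NE1′-OG1′-RESID° part (ii), 2026-08-19T09:12:09Z; v1 p185602 commit ea18a3a1f959; v1.1 = §6 + these
bracketed header sentences, nothing of v1 changed).
-/

namespace Literature.MathematicalPhysics.QuantumFieldTheory.Balaban1983to89.T4RelativeCombGradient

open Finset
open B8Lemma1Lattice (e site site_add_single InBlock inBlock_site_iff exists_offset_of_inBlock lt_of_add_single)
open T4RelativeLadder (UnitaryLike norm_conj_sub_one_eq norm_triple_sub_one_le norm_mul_unit_le norm_unit_mul_le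
  norm_inv_sub_one_le ladderMap ladderMap_sub norm_ladderMap_sub_self_le norm_ladderMap_sub_ladderMap_le
  norm_shift_sub_le norm_inv_sub_inv_le norm_conj_sub_conj_le)
open T4RelativeComb (Cfg gaugeAct plaq plaq_gaugeAct unitaryLike_gaugeAct unitaryLike_plaq IsTree isTree_add_single
  low low_ne_zero low_le isTree_low pred' pred'_apply pred'_le pred'_apply_of_ne pred'_add_single isTree_pred'
  combGauge unitaryLike_combGauge gaugeAct_combGauge_tree defect defect_tree defect_rung ladderLen ladderLen_eq_succ
  ladderLen_le isTree_of_ladderLen_eq_zero PlaqSup norm_defect_sub_one_le_ladderLen relGauge)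

variable {R : Type*} [NormedRing R] {d : ℕ}

/-- [folklore] Sites of `ℤ^d` — the SAME carrier as `B8Lemma1Lattice.Site d` / `T4RelativeComb.Site d` (definitionally;
re-declared here only so that the bare name is not captured by an unrelated `Site` of an ancestor namespace). -/
abbrev Site (d : ℕ) : Type := Fin d → ℤ

example (d : ℕ) : Site d = T4RelativeComb.Site d := rfl

/-! ## §0  Generic one-square algebra: the ladder map `F(X) = a⁻¹·(P₁·X·P₀⁻¹)·a` on a NEAR-IDENTITY element -/

/-- [folklore] `‖F(X)‖ ≤ ‖X‖` for unitary-like `a, P₁, P₀`. -/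
theorem norm_ladderMap_le {hb P₁ P₀ : Rˣ} (hhb : UnitaryLike hb) (hP₁ : UnitaryLike P₁) (hP₀ : UnitaryLike P₀)
    (X : R) : ‖ladderMap hb P₁ P₀ X‖ ≤ ‖X‖ := by
  unfold ladderMap
  calc ‖((hb⁻¹ : Rˣ) : R) * ((P₁ : R) * X * ↑P₀⁻¹) * hb‖ ≤ ‖(P₁ : R) * X * ↑P₀⁻¹‖ :=
        (norm_mul_unit_le hhb _).trans (norm_unit_mul_le hhb.inv _)
    _ ≤ ‖X‖ := (norm_mul_unit_le hP₀.inv _).trans (norm_unit_mul_le hP₁ _)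

/-- [folklore] `‖F(1) − 1‖ ≤ ‖P₁ − P₀‖` (conjugation by the unitary-like rail is an isometry on `· − 1`,
`T4RelativeLadder.norm_conj_sub_one_eq`; `P₁P₀⁻¹ − 1 = (P₁ − P₀)P₀⁻¹`). -/
theorem norm_ladderMap_one_sub_one_le {hb P₁ P₀ : Rˣ} (hhb : UnitaryLike hb) (hP₀ : UnitaryLike P₀) :
    ‖ladderMap hb P₁ P₀ 1 - 1‖ ≤ ‖(P₁ : R) - P₀‖ := by
  have e1 : ladderMap hb P₁ P₀ (1 : R) = ((hb⁻¹ : Rˣ) : R) * ((P₁ : R) * ↑P₀⁻¹) * ↑(hb⁻¹)⁻¹ := by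
    simp only [ladderMap, mul_one, inv_inv]
  rw [e1, norm_conj_sub_one_eq hhb.inv]
  have e2 : (P₁ : R) * ↑P₀⁻¹ - 1 = ((P₁ : R) - P₀) * ↑P₀⁻¹ := by
    rw [sub_mul, Units.mul_inv]
  rw [e2]
  exact norm_mul_unit_le hP₀.inv _

/-- [folklore] THE LOCAL ONE-SQUARE DIFFERENCE on a near-identity element:
`‖F(X) − X‖ ≤ ‖P₁ − P₀‖ + ‖X − 1‖·(‖P₁ − 1‖ + ‖P₀ − 1‖ + 2‖a − 1‖)` — linearity `F(X) − X = (F(X−1) − (X−1)) +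
(F(1) − 1)`, then `T4RelativeLadder.norm_ladderMap_sub_self_le` on the small element `X − 1`. -/
theorem norm_ladderMap_sub_le {hb P₁ P₀ : Rˣ} (hhb : UnitaryLike hb) (hP₀ : UnitaryLike P₀) (X : R) :
    ‖ladderMap hb P₁ P₀ X - X‖ ≤
      ‖(P₁ : R) - P₀‖ + ‖X - 1‖ * (‖(P₁ : R) - 1‖ + ‖(P₀ : R) - 1‖ + 2 * ‖(hb : R) - 1‖) := by
  have e : ladderMap hb P₁ P₀ X - X = (ladderMap hb P₁ P₀ (X - 1) - (X - 1)) + (ladderMap hb P₁ P₀ 1 - 1) := by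
    rw [← ladderMap_sub]; abel
  rw [e]
  calc _ ≤ ‖ladderMap hb P₁ P₀ (X - 1) - (X - 1)‖ + ‖ladderMap hb P₁ P₀ 1 - 1‖ := norm_add_le _ _
    _ ≤ ‖X - 1‖ * (‖(P₁ : R) - 1‖ + ‖(P₀ : R) - 1‖ + 2 * ‖(hb : R) - 1‖) + ‖(P₁ : R) - P₀‖ :=
        add_le_add (norm_ladderMap_sub_self_le hhb hP₀ _) (norm_ladderMap_one_sub_one_le hhb hP₀)
    _ = _ := add_comm _ _

/-- [folklore] TWO PARALLEL SQUARES COMPARED: `‖F′(X′) − F(X)‖ ≤ ‖X′ − X‖ + (2‖a′ − a‖(‖X′ − 1‖ + ‖P₁′ − P₀′‖) +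
‖(P₁′ − P₀′) − (P₁ − P₀)‖ + ‖P₀′ − P₀‖(2‖X′ − 1‖ + ‖P₁ − P₀‖))` — `F′(X′) − F(X) = F(X′ − X) + [F′ − F](X′)`, the
contraction `norm_ladderMap_le` and `T4RelativeLadder.norm_ladderMap_sub_ladderMap_le` (BY NAME).  The bracket is FIRST
ORDER IN THE DIFFERENCES OF THE DATA of the two squares (rails `a, a′`, deviations `P₁ − P₀, P₁′ − P₀′`, base
plaquettes `P₀, P₀′`); the term `‖X′ − X‖` PROPAGATES the difference one square down the ladders — the transverse
difference is NOT local. -/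
theorem norm_ladderMap_pair_sub_le {a a' P₁ P₀ P₁' P₀' X' : Rˣ} (ha : UnitaryLike a) (ha' : UnitaryLike a')
    (hP₁ : UnitaryLike P₁) (hP₁' : UnitaryLike P₁') (hP₀ : UnitaryLike P₀) (hP₀' : UnitaryLike P₀')
    (hX' : UnitaryLike X') (X : R) :
    ‖ladderMap a' P₁' P₀' (X' : R) - ladderMap a P₁ P₀ X‖ ≤
      ‖(X' : R) - X‖ +
        (2 * ‖(a' : R) - a‖ * (‖(X' : R) - 1‖ + ‖(P₁' : R) - P₀'‖) + ‖((P₁' : R) - P₀') - ((P₁ : R) - P₀)‖ +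
          ‖(P₀' : R) - P₀‖ * (2 * ‖(X' : R) - 1‖ + ‖(P₁ : R) - P₀‖)) := by
  have split : ladderMap a' P₁' P₀' (X' : R) - ladderMap a P₁ P₀ X =
      ladderMap a P₁ P₀ ((X' : R) - X) + (ladderMap a' P₁' P₀' (X' : R) - ladderMap a P₁ P₀ (X' : R)) := by
    rw [← ladderMap_sub]; abel
  rw [split]
  exact (norm_add_le _ _).trans (add_le_add (norm_ladderMap_le ha hP₁ hP₀ _)
    (norm_ladderMap_sub_ladderMap_le ha ha' hP₁' hP₀ hP₀' hX'))

/-! ## §1  Offsets: tree-like directions, `low`, `pred'` under a transverse unit step -/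

/-- [folklore] If all coordinates of `k` below `μ` vanish and `k μ ≠ 0`, then `low k = μ`. -/
theorem low_eq_of_isTree {k : Fin d → ℕ} {μ : Fin d} (hk : IsTree k μ) (hμ : k μ ≠ 0) (h : ∃ ρ, k ρ ≠ 0) :
    low k h = μ := by
  refine le_antisymm (low_le k h hμ) (not_lt.1 fun hlt => ?_)
  exact low_ne_zero k h (hk _ (Fin.lt_def.1 hlt))

/-- [folklore] A unit step in direction `μ` keeps the coordinates below `μ` at zero. -/
theorem isTree_add_single_self {k : Fin d → ℕ} {μ : Fin d} (hk : IsTree k μ) : IsTree (k + Pi.single μ 1) μ := by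
  intro κ hκ
  have hne : κ ≠ μ := by intro h; subst h; exact lt_irrefl _ hκ
  simp [hk κ hκ, Pi.single_eq_of_ne hne]

/-- [folklore] After a unit step in a tree-like direction `μ` the peeling direction is `μ` … -/
theorem low_add_single_self {k : Fin d → ℕ} {μ : Fin d} (hk : IsTree k μ) (h : ∃ ρ, (k + Pi.single μ 1 : Fin d → ℕ) ρ ≠ 0) :
    low (k + Pi.single μ 1) h = μ :=
  low_eq_of_isTree (isTree_add_single_self hk) (by simp) h

/-- [folklore] … and the foot of the peeled bond is the original offset. -/
theorem pred'_add_single_self {k : Fin d → ℕ} {μ : Fin d} (hk : IsTree k μ) (h : ∃ ρ, (k + Pi.single μ 1 : Fin d → ℕ) ρ ≠ 0) :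
    pred' (k + Pi.single μ 1) h = k := by
  have e1 := pred'_add_single (k + Pi.single μ 1) h
  rw [low_add_single_self hk h] at e1
  exact add_right_cancel e1

/-- [folklore] A unit step in a direction `μ` ABOVE the peeling direction does not change the peeling direction … -/
theorem low_add_single_of_lt (k : Fin d → ℕ) (h : ∃ ρ, k ρ ≠ 0) {μ : Fin d} (hμ : ((low k h : Fin d) : ℕ) < μ)
    (h' : ∃ ρ, (k + Pi.single μ 1 : Fin d → ℕ) ρ ≠ 0) : low (k + Pi.single μ 1) h' = low k h := by
  have hne : low k h ≠ μ := fun h0 => by rw [h0] at hμ; exact lt_irrefl _ hμ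
  refine low_eq_of_isTree (isTree_add_single (isTree_low k h) hμ) ?_ h'
  simp [Pi.single_eq_of_ne hne, low_ne_zero k h]

/-- [folklore] … and commutes with taking the foot: `pred' (k + e_μ) = pred' k + e_μ`. -/
theorem pred'_add_single_of_lt (k : Fin d → ℕ) (h : ∃ ρ, k ρ ≠ 0) {μ : Fin d} (hμ : ((low k h : Fin d) : ℕ) < μ)
    (h' : ∃ ρ, (k + Pi.single μ 1 : Fin d → ℕ) ρ ≠ 0) : pred' (k + Pi.single μ 1) h' = pred' k h + Pi.single μ 1 := by
  have hne : low k h ≠ μ := fun h0 => by rw [h0] at hμ; exact lt_irrefl _ hμ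
  have hk0 := low_ne_zero k h
  funext κ
  simp only [pred'_apply, Pi.add_apply, low_add_single_of_lt k h hμ h']
  by_cases h1 : κ = low k h
  · rw [h1, Pi.single_eq_same, Pi.single_eq_of_ne hne]; omega
  · rw [Pi.single_eq_of_ne h1]; omega

/-- [folklore] `site z k ∈ B(z)` from offsets `< L` (`B8Lemma1Lattice.inBlock_site_iff`, one direction). -/
theorem inBlock_of_lt {L : ℕ} (z : Site d) {k : Fin d → ℕ} (hk : ∀ κ, k κ < L) : InBlock L z (site z k) :=
  (inBlock_site_iff L z k).2 hk

/-- [folklore] THE CROSS LENGTH of the pair of bonds `⟨z+k, ·+e_ν⟩`, `⟨z+k+e_μ, ·+e_ν⟩`: the number of ladder squares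
BELOW BOTH `μ` AND `ν`, `Σ_{ρ < min(μ,ν)} k_ρ` — the number of times the transverse difference in direction `μ` is
propagated before it becomes local (`≤ ladderLen k ν ≤ (d−1)(L−1)`). -/
def crossLen (k : Fin d → ℕ) (μ ν : Fin d) : ℕ :=
  ∑ ρ ∈ univ.filter (fun ρ : Fin d => (ρ : ℕ) < μ ∧ (ρ : ℕ) < ν), k ρ

/-- [folklore] `crossLen ≤ ladderLen`. -/
theorem crossLen_le_ladderLen (k : Fin d → ℕ) (μ ν : Fin d) : crossLen k μ ν ≤ ladderLen k ν := by
  unfold crossLen ladderLen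
  exact Finset.sum_le_sum_of_subset fun ρ hρ => by
    simp only [Finset.mem_filter, Finset.mem_univ, true_and] at hρ ⊢; exact hρ.2

/-- [folklore] Cross length zero: every coordinate below both `μ` and `ν` vanishes. -/
theorem eq_zero_of_crossLen_eq_zero {k : Fin d → ℕ} {μ ν : Fin d} (h0 : crossLen k μ ν = 0) :
    ∀ κ : Fin d, (κ : ℕ) < μ → (κ : ℕ) < ν → k κ = 0 := fun κ hμ hν =>
  (Finset.sum_eq_zero_iff.1 h0) κ (Finset.mem_filter.2 ⟨Finset.mem_univ _, hμ, hν⟩)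

/-- [folklore] Positive cross length: `k ≠ 0` and the peeling direction lies below both `μ` and `ν`. -/
theorem low_lt_of_crossLen_ne_zero {k : Fin d → ℕ} {μ ν : Fin d} (hN : crossLen k μ ν ≠ 0) :
    ∃ h : (∃ ρ, k ρ ≠ 0), ((low k h : Fin d) : ℕ) < μ ∧ ((low k h : Fin d) : ℕ) < ν := by
  obtain ⟨ρ₁, hρ₁, hkρ₁⟩ : ∃ ρ ∈ univ.filter (fun ρ : Fin d => (ρ : ℕ) < μ ∧ (ρ : ℕ) < ν), k ρ ≠ 0 :=
    Finset.exists_ne_zero_of_sum_ne_zero hN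
  have h : ∃ ρ, k ρ ≠ 0 := ⟨ρ₁, hkρ₁⟩
  have hle : ((low k h : Fin d) : ℕ) ≤ ρ₁ := low_le k h hkρ₁
  simp only [Finset.mem_filter, Finset.mem_univ, true_and] at hρ₁
  exact ⟨h, hle.trans_lt hρ₁.1, hle.trans_lt hρ₁.2⟩

/-- [folklore] Peeling the last tree bond below `min(μ,ν)` shortens the cross length by one. -/
theorem crossLen_eq_succ (k : Fin d → ℕ) (h : ∃ ρ, k ρ ≠ 0) {μ ν : Fin d} (hμ : ((low k h : Fin d) : ℕ) < μ)
    (hν : ((low k h : Fin d) : ℕ) < ν) : crossLen k μ ν = crossLen (pred' k h) μ ν + 1 := by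
  unfold crossLen
  conv_lhs => rw [← pred'_add_single k h]
  simp only [Pi.add_apply]
  rw [Finset.sum_add_distrib, Finset.sum_pi_single',
    if_pos (show low k h ∈ univ.filter (fun ρ : Fin d => (ρ : ℕ) < μ ∧ (ρ : ℕ) < ν) from
      Finset.mem_filter.2 ⟨Finset.mem_univ _, hμ, hν⟩)]

/-! ## §2  ALONG the peeling direction: the first difference of the comb defect is LOCAL -/

section Along

variable [NormOneClass R]

/-- [folklore] The comb defect is unitary-like for unitary-like pairs. -/
theorem unitaryLike_defect {U₀ U₁ : Cfg d R} (hU₀ : ∀ x ν, UnitaryLike (U₀ x ν))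
    (hU₁ : ∀ x ν, UnitaryLike (U₁ x ν)) (z x : Site d) (ν : Fin d) : UnitaryLike (defect U₀ U₁ z x ν) :=
  (unitaryLike_gaugeAct (unitaryLike_combGauge hU₀ hU₁ z) hU₁ x ν).mul (hU₀ x ν).inv

omit [NormOneClass R] in
/-- [folklore] THE RELATIVE STOKES SQUARE AS A LADDER MAP in the ring: `W⟨z+k,·+e_ν⟩ = F(W⟨y,·+e_ν⟩)` with
`F = T4RelativeLadder.ladderMap (U₀⟨y,y+e_ρ₀⟩) (plaq(U₁^g)(y;ρ₀,ν)) (plaq U₀(y;ρ₀,ν))`, `y = z + pred' k`, `ρ₀ = low k`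
(`T4RelativeComb.defect_rung`, BY NAME). -/
theorem defect_rung_eq_ladderMap (U₀ U₁ : Cfg d R) (z : Site d) (k : Fin d → ℕ) (h : ∃ ρ, k ρ ≠ 0) (ν : Fin d)
    (hν : ((low k h : Fin d) : ℕ) < ν) :
    (defect U₀ U₁ z (site z k) ν : R) =
      ladderMap (U₀ (site z (pred' k h)) (low k h))
        (plaq (gaugeAct (combGauge U₀ U₁ z) U₁) (site z (pred' k h)) (low k h) ν)
        (plaq U₀ (site z (pred' k h)) (low k h) ν)
        (defect U₀ U₁ z (site z (pred' k h)) ν : R) := by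
  rw [defect_rung U₀ U₁ z k h ν hν]
  simp only [ladderMap, Units.val_mul]

omit [NormOneClass R] in
/-- [folklore] ALONG THE LADDER THE FIRST DIFFERENCE IS LOCAL — the lattice twin of
`T4RelativeLadder.norm_defect_succ_sub_defect_le`: for `k ≠ 0` with `ρ₀ = low k < ν` and `y = z + pred' k`
(so `z + k = y + e_ρ₀`), `‖W⟨z+k,·+e_ν⟩ − W⟨y,·+e_ν⟩‖ ≤ ‖plaq(U₁^g)(y;ρ₀,ν) − plaq U₀(y;ρ₀,ν)‖ + ‖W⟨y,·+e_ν⟩ − 1‖·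
(‖plaq(U₁^g)(y;ρ₀,ν) − 1‖ + ‖plaq U₀(y;ρ₀,ν) − 1‖ + 2‖U₀⟨y,y+e_ρ₀⟩ − 1‖)`: ONE relative plaquette deviation (of the
square being peeled) plus (curvatures + rail deviation) × (the defect already accumulated).  Only `U₀` needs to be
unitary-like. -/
theorem norm_defect_rung_sub_defect_le {U₀ U₁ : Cfg d R} (hU₀ : ∀ x ν, UnitaryLike (U₀ x ν)) (z : Site d)
    (k : Fin d → ℕ) (h : ∃ ρ, k ρ ≠ 0) (ν : Fin d) (hν : ((low k h : Fin d) : ℕ) < ν) :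
    ‖(defect U₀ U₁ z (site z k) ν : R) - defect U₀ U₁ z (site z (pred' k h)) ν‖ ≤
      ‖(plaq (gaugeAct (combGauge U₀ U₁ z) U₁) (site z (pred' k h)) (low k h) ν : R) -
          plaq U₀ (site z (pred' k h)) (low k h) ν‖ +
        ‖(defect U₀ U₁ z (site z (pred' k h)) ν : R) - 1‖ *
          (‖(plaq (gaugeAct (combGauge U₀ U₁ z) U₁) (site z (pred' k h)) (low k h) ν : R) - 1‖ +
            ‖(plaq U₀ (site z (pred' k h)) (low k h) ν : R) - 1‖ +
            2 * ‖(U₀ (site z (pred' k h)) (low k h) : R) - 1‖) := by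
  rw [defect_rung_eq_ladderMap U₀ U₁ z k h ν hν]
  exact norm_ladderMap_sub_le (hU₀ _ _) (unitaryLike_plaq hU₀ _ _ _) _

/-- [folklore] ALONG THE LADDER, PACKAGED IN SUP FORM: with the gauge-fixed per-square bound `s` (the `PlaqSup` input of
`T4RelativeComb.norm_defect_sub_one_le_ladderLen`), the base curvature `q₀` and a bound `τ` on `‖U₀⟨b⟩ − 1‖` over the
bonds of `B(z)` (`τ = 0` when `U₀` is axial from `z`, `T4RelativeComb.axial_tree`), every peeling step inside the block
satisfies `‖W⟨z+k,·+e_ν⟩ − W⟨z+pred′k,·+e_ν⟩‖ ≤ s + ladderLen(pred′ k)·s·(2q₀ + s + 2τ)`: FIRST ORDER `s` plus SECOND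
ORDER (ladder × (curvature + rail deviation)).  Pure count; `s, q₀, τ` are hypotheses. -/
theorem norm_defect_rung_sub_defect_le_of_sup {U₀ U₁ : Cfg d R} {z : Site d} {L : ℕ} {s q₀ τ : ℝ}
    (hU₀ : ∀ x ν, UnitaryLike (U₀ x ν)) (hU₁ : ∀ x ν, UnitaryLike (U₁ x ν))
    (hs : PlaqSup L z (fun y ρ ν =>
      ‖(plaq (gaugeAct (combGauge U₀ U₁ z) U₁) y ρ ν : R) - plaq U₀ y ρ ν‖) s)
    (hq₀ : PlaqSup L z (fun y ρ ν => ‖(plaq U₀ y ρ ν : R) - 1‖) q₀)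
    (hτ : ∀ x ρ, InBlock L z x → InBlock L z (x + e ρ) → ‖(U₀ x ρ : R) - 1‖ ≤ τ) (hs0 : 0 ≤ s)
    (k : Fin d → ℕ) (hk : ∀ κ, k κ < L) (h : ∃ ρ, k ρ ≠ 0) (ν : Fin d) (hν : ((low k h : Fin d) : ℕ) < ν)
    (hνL : k ν + 1 < L) :
    ‖(defect U₀ U₁ z (site z k) ν : R) - defect U₀ U₁ z (site z (pred' k h)) ν‖ ≤
      s + (ladderLen (pred' k h) ν : ℝ) * s * (2 * q₀ + s + 2 * τ) := by
  have hneν : ν ≠ low k h := by intro h'; rw [← h'] at hν; exact lt_irrefl _ hν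
  have hpL : ∀ κ, pred' k h κ < L := fun κ => (pred'_le k h κ).trans_lt (hk κ)
  have hpν : pred' k h ν + 1 < L := by rw [pred'_apply_of_ne k h hneν]; exact hνL
  have hx : site z (pred' k h) + e (low k h) = site z k := by rw [← site_add_single, pred'_add_single]
  have c1 : InBlock L z (site z (pred' k h)) := inBlock_of_lt z hpL
  have c2 : InBlock L z (site z (pred' k h) + e (low k h)) := by rw [hx]; exact inBlock_of_lt z hk
  have c3 : InBlock L z (site z (pred' k h) + e ν) := by
    rw [← site_add_single]; exact inBlock_of_lt z (lt_of_add_single hpL hpν)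
  have c4 : InBlock L z (site z (pred' k h) + e (low k h) + e ν) := by
    rw [hx, ← site_add_single]; exact inBlock_of_lt z (lt_of_add_single hk hνL)
  have hE : ‖(plaq (gaugeAct (combGauge U₀ U₁ z) U₁) (site z (pred' k h)) (low k h) ν : R) -
      plaq U₀ (site z (pred' k h)) (low k h) ν‖ ≤ s := hs _ _ _ (fun h' => hneν h'.symm) c1 c2 c3 c4
  have hP₀ : ‖(plaq U₀ (site z (pred' k h)) (low k h) ν : R) - 1‖ ≤ q₀ :=
    hq₀ _ _ _ (fun h' => hneν h'.symm) c1 c2 c3 c4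
  have hP₁ : ‖(plaq (gaugeAct (combGauge U₀ U₁ z) U₁) (site z (pred' k h)) (low k h) ν : R) - 1‖ ≤ s + q₀ :=
    (norm_sub_le_norm_sub_add_norm_sub _ _ _).trans (add_le_add hE hP₀)
  have ha : ‖(U₀ (site z (pred' k h)) (low k h) : R) - 1‖ ≤ τ := hτ _ _ c1 c2
  have hW : ‖(defect U₀ U₁ z (site z (pred' k h)) ν : R) - 1‖ ≤ (ladderLen (pred' k h) ν : ℝ) * s :=
    norm_defect_sub_one_le_ladderLen hU₀ hU₁ hs (pred' k h) hpL ν hpν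
  have hWnn : 0 ≤ (ladderLen (pred' k h) ν : ℝ) * s := mul_nonneg (Nat.cast_nonneg _) hs0
  calc _ ≤ _ := norm_defect_rung_sub_defect_le hU₀ z k h ν hν
    _ ≤ s + (ladderLen (pred' k h) ν : ℝ) * s * ((s + q₀) + q₀ + 2 * τ) :=
        add_le_add hE (mul_le_mul hW (add_le_add (add_le_add hP₁ hP₀) (by linarith)) (by positivity) hWnn)
    _ = _ := by ring

/-- [folklore] THE SAME, INDEXED BY THE DIRECTION OF THE DIFFERENCE: for an offset `k` that is TREE-LIKE BELOW `μ`
(`IsTree k μ`: all coordinates below `μ` vanish) and `μ < ν`, the first difference of the defect of the `ν`-bonds in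
direction `μ` is local: `‖W⟨z+k+e_μ,·+e_ν⟩ − W⟨z+k,·+e_ν⟩‖ ≤ s + ladderLen(k)·s·(2q₀ + s + 2τ)`.  (For `IsTree k μ` and
`μ ≥ ν` at an offset tree-like below `ν` both bonds are tree bonds and the difference VANISHES, `gradient_eq_zero_of_isTree`.) -/
theorem norm_gradient_treeDir_le {U₀ U₁ : Cfg d R} {z : Site d} {L : ℕ} {s q₀ τ : ℝ}
    (hU₀ : ∀ x ν, UnitaryLike (U₀ x ν)) (hU₁ : ∀ x ν, UnitaryLike (U₁ x ν))
    (hs : PlaqSup L z (fun y ρ ν =>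
      ‖(plaq (gaugeAct (combGauge U₀ U₁ z) U₁) y ρ ν : R) - plaq U₀ y ρ ν‖) s)
    (hq₀ : PlaqSup L z (fun y ρ ν => ‖(plaq U₀ y ρ ν : R) - 1‖) q₀)
    (hτ : ∀ x ρ, InBlock L z x → InBlock L z (x + e ρ) → ‖(U₀ x ρ : R) - 1‖ ≤ τ) (hs0 : 0 ≤ s)
    {k : Fin d → ℕ} {μ ν : Fin d} (hkμ : IsTree k μ) (hμν : (μ : ℕ) < ν)
    (hk' : ∀ κ, (k + Pi.single μ 1 : Fin d → ℕ) κ < L) (hνL : k ν + 1 < L) :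
    ‖(defect U₀ U₁ z (site z (k + Pi.single μ 1)) ν : R) - defect U₀ U₁ z (site z k) ν‖ ≤
      s + (ladderLen k ν : ℝ) * s * (2 * q₀ + s + 2 * τ) := by
  have h' : ∃ ρ, (k + Pi.single μ 1 : Fin d → ℕ) ρ ≠ 0 := ⟨μ, by simp⟩
  have hneq : ν ≠ μ := fun h0 => by rw [h0] at hμν; exact lt_irrefl _ hμν
  have hν'L : (k + Pi.single μ 1 : Fin d → ℕ) ν + 1 < L := by simpa [Pi.single_eq_of_ne hneq] using hνL
  have H := norm_defect_rung_sub_defect_le_of_sup hU₀ hU₁ hs hq₀ hτ hs0 (k + Pi.single μ 1) hk' h' ν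
    (by rw [low_add_single_self hkμ h']; exact hμν) hν'L
  rw [pred'_add_single_self hkμ h'] at H
  exact H

omit [NormOneClass R] in
/-- [folklore] Differences in a direction `μ ≥ ν` at an offset tree-like below `ν` vanish (both bonds are tree bonds,
`T4RelativeComb.defect_tree`). -/
theorem gradient_eq_zero_of_isTree (U₀ U₁ : Cfg d R) (z : Site d) {k : Fin d → ℕ} {μ ν : Fin d}
    (hkν : IsTree k ν) (hνμ : (ν : ℕ) ≤ μ) :
    (defect U₀ U₁ z (site z (k + Pi.single μ 1)) ν : R) - defect U₀ U₁ z (site z k) ν = 0 := by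
  have hk'ν : IsTree (k + Pi.single μ 1) ν := by
    intro κ hκ
    have hne : κ ≠ μ := by intro h0; subst h0; exact absurd (lt_of_lt_of_le hκ hνμ) (lt_irrefl _)
    simp [hkν κ hκ, Pi.single_eq_of_ne hne]
  rw [defect_tree U₀ U₁ z hk'ν, defect_tree U₀ U₁ z hkν, sub_self]

end Along

/-! ## §3  ACROSS: the transverse first difference is a PARALLEL-LADDER difference (non-local; ladder sum of gradients) -/

section Across

variable [NormOneClass R]

/-- [folklore] ONE PROPAGATION STEP.  For `k ≠ 0` with `ρ₀ = low k` below both `μ` and `ν`, `y = z + pred′ k`: the two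
bonds `⟨z+k, ·+e_ν⟩`, `⟨z+k+e_μ, ·+e_ν⟩` are the tops of the PARALLEL squares `(y; ρ₀, ν)`, `(y+e_μ; ρ₀, ν)`, and
`‖W⟨z+k+e_μ⟩ − W⟨z+k⟩‖ ≤ ‖W⟨y+e_μ⟩ − W⟨y⟩‖ + 2‖U₀⟨y+e_μ,ρ₀⟩ − U₀⟨y,ρ₀⟩‖(‖W⟨y+e_μ⟩ − 1‖ + ‖E(y+e_μ)‖) + ‖E(y+e_μ) −
E(y)‖ + ‖plaq U₀(y+e_μ) − plaq U₀(y)‖(2‖W⟨y+e_μ⟩ − 1‖ + ‖E(y)‖)` with `E = plaq(U₁^g) − plaq U₀` the gauge-fixed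
deviation of the square: the difference one square DOWN plus sources that are PLAIN lattice differences, in direction
`μ`, of the data of the square (base rail, gauge-fixed deviation, base plaquette).  `norm_ladderMap_pair_sub_le` on
`T4RelativeComb.defect_rung`. -/
theorem norm_transverse_step_le {U₀ U₁ : Cfg d R} (hU₀ : ∀ x ν, UnitaryLike (U₀ x ν))
    (hU₁ : ∀ x ν, UnitaryLike (U₁ x ν)) (z : Site d) (k : Fin d → ℕ) (h : ∃ ρ, k ρ ≠ 0) {μ ν : Fin d}
    (hμ : ((low k h : Fin d) : ℕ) < μ) (hν : ((low k h : Fin d) : ℕ) < ν) :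
    ‖(defect U₀ U₁ z (site z (k + Pi.single μ 1)) ν : R) - defect U₀ U₁ z (site z k) ν‖ ≤
      ‖(defect U₀ U₁ z (site z (pred' k h) + e μ) ν : R) - defect U₀ U₁ z (site z (pred' k h)) ν‖ +
        (2 * ‖(U₀ (site z (pred' k h) + e μ) (low k h) : R) - U₀ (site z (pred' k h)) (low k h)‖ *
            (‖(defect U₀ U₁ z (site z (pred' k h) + e μ) ν : R) - 1‖ +
              ‖(plaq (gaugeAct (combGauge U₀ U₁ z) U₁) (site z (pred' k h) + e μ) (low k h) ν : R) -
                plaq U₀ (site z (pred' k h) + e μ) (low k h) ν‖) +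
          ‖((plaq (gaugeAct (combGauge U₀ U₁ z) U₁) (site z (pred' k h) + e μ) (low k h) ν : R) -
              plaq U₀ (site z (pred' k h) + e μ) (low k h) ν) -
            ((plaq (gaugeAct (combGauge U₀ U₁ z) U₁) (site z (pred' k h)) (low k h) ν : R) -
              plaq U₀ (site z (pred' k h)) (low k h) ν)‖ +
          ‖(plaq U₀ (site z (pred' k h) + e μ) (low k h) ν : R) - plaq U₀ (site z (pred' k h)) (low k h) ν‖ *
            (2 * ‖(defect U₀ U₁ z (site z (pred' k h) + e μ) ν : R) - 1‖ +
              ‖(plaq (gaugeAct (combGauge U₀ U₁ z) U₁) (site z (pred' k h)) (low k h) ν : R) -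
                plaq U₀ (site z (pred' k h)) (low k h) ν‖)) := by
  have hg := unitaryLike_combGauge hU₀ hU₁ z
  have hne : low k h ≠ μ := fun h0 => by rw [h0] at hμ; exact lt_irrefl _ hμ
  have h' : ∃ ρ, (k + Pi.single μ 1 : Fin d → ℕ) ρ ≠ 0 :=
    ⟨low k h, by simp [Pi.single_eq_of_ne hne, low_ne_zero k h]⟩
  have e1 := defect_rung_eq_ladderMap U₀ U₁ z (k + Pi.single μ 1) h' ν
    (by rw [low_add_single_of_lt k h hμ h']; exact hν)
  rw [pred'_add_single_of_lt k h hμ h', low_add_single_of_lt k h hμ h', site_add_single z (pred' k h) μ] at e1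
  rw [e1, defect_rung_eq_ladderMap U₀ U₁ z k h ν hν]
  exact norm_ladderMap_pair_sub_le (hU₀ _ _) (hU₀ _ _) (unitaryLike_plaq (unitaryLike_gaugeAct hg hU₁) _ _ _)
    (unitaryLike_plaq (unitaryLike_gaugeAct hg hU₁) _ _ _) (unitaryLike_plaq hU₀ _ _ _) (unitaryLike_plaq hU₀ _ _ _)
    (unitaryLike_defect hU₀ hU₁ z _ _) _

/-- [folklore] THE TRANSVERSE FIRST DIFFERENCE, UNROLLED (induction on the cross length, one `norm_transverse_step_le`
per square below `min(μ,ν)`, the foot being the LOCAL tree-direction difference of §2 or zero).  Inputs, all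
HYPOTHESES in sup form over the block `B(z)`: the gauge-fixed per-square deviation `s`, the base curvature `q₀`, the
base bond deviation `τ`, and three PLAIN-GRADIENT sups in direction `μ` — `γU` (base bond variables), `γP` (base
plaquettes), `γE` (the gauge-fixed deviation field `E = plaq(U₁^g) − plaq U₀`; the typed form of the cell's located
missing input (O2c) "incl. gradients").  Output: `‖W⟨z+k+e_μ,·+e_ν⟩ − W⟨z+k,·+e_ν⟩‖ ≤ s·(1 + C(2q₀ + s + 2τ)) +
crossLen·(2γU(Cs + s) + γE + γP(2Cs + s))`, `C = (d−1)(L−1)`.  NO bound in terms of `s, q₀, τ` alone is asserted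
for `crossLen > 0` — the coefficient of `γE` is the cross length itself. -/
theorem norm_transverse_diff_le {U₀ U₁ : Cfg d R} {z : Site d} {L : ℕ} {μ ν : Fin d}
    {s q₀ τ γU γP γE : ℝ}
    (hU₀ : ∀ x ν, UnitaryLike (U₀ x ν)) (hU₁ : ∀ x ν, UnitaryLike (U₁ x ν))
    (hs : PlaqSup L z (fun y ρ ν =>
      ‖(plaq (gaugeAct (combGauge U₀ U₁ z) U₁) y ρ ν : R) - plaq U₀ y ρ ν‖) s)
    (hq₀ : PlaqSup L z (fun y ρ ν => ‖(plaq U₀ y ρ ν : R) - 1‖) q₀)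
    (hτ : ∀ x ρ, InBlock L z x → InBlock L z (x + e ρ) → ‖(U₀ x ρ : R) - 1‖ ≤ τ)
    (hγU : ∀ x ρ, InBlock L z x → InBlock L z (x + e ρ) → InBlock L z (x + e μ) → InBlock L z (x + e μ + e ρ) →
      ‖(U₀ (x + e μ) ρ : R) - U₀ x ρ‖ ≤ γU)
    (hγP : ∀ y ρ ν', ρ ≠ ν' → InBlock L z y → InBlock L z (y + e ρ) → InBlock L z (y + e ν') →
      InBlock L z (y + e ρ + e ν') → InBlock L z (y + e μ) → InBlock L z (y + e μ + e ρ) →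
      InBlock L z (y + e μ + e ν') → InBlock L z (y + e μ + e ρ + e ν') →
      ‖(plaq U₀ (y + e μ) ρ ν' : R) - plaq U₀ y ρ ν'‖ ≤ γP)
    (hγE : ∀ y ρ ν', ρ ≠ ν' → InBlock L z y → InBlock L z (y + e ρ) → InBlock L z (y + e ν') →
      InBlock L z (y + e ρ + e ν') → InBlock L z (y + e μ) → InBlock L z (y + e μ + e ρ) →
      InBlock L z (y + e μ + e ν') → InBlock L z (y + e μ + e ρ + e ν') →
      ‖((plaq (gaugeAct (combGauge U₀ U₁ z) U₁) (y + e μ) ρ ν' : R) - plaq U₀ (y + e μ) ρ ν') -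
          ((plaq (gaugeAct (combGauge U₀ U₁ z) U₁) y ρ ν' : R) - plaq U₀ y ρ ν')‖ ≤ γE)
    (hs0 : 0 ≤ s) (hq0 : 0 ≤ q₀) (hτ0 : 0 ≤ τ) (hγU0 : 0 ≤ γU) (hγP0 : 0 ≤ γP)
    (k : Fin d → ℕ) (hk' : ∀ κ, (k + Pi.single μ 1 : Fin d → ℕ) κ < L)
    (hν'L : (k + Pi.single μ 1 : Fin d → ℕ) ν + 1 < L) :
    ‖(defect U₀ U₁ z (site z (k + Pi.single μ 1)) ν : R) - defect U₀ U₁ z (site z k) ν‖ ≤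
      s * (1 + ((d : ℝ) - 1) * ((L : ℝ) - 1) * (2 * q₀ + s + 2 * τ)) +
        (crossLen k μ ν : ℝ) *
          (2 * γU * (((d : ℝ) - 1) * ((L : ℝ) - 1) * s + s) + γE +
            γP * (2 * (((d : ℝ) - 1) * ((L : ℝ) - 1) * s) + s)) := by
  -- the constants
  have hd1 : (1 : ℝ) ≤ d := by have := μ.isLt; exact_mod_cast (show 1 ≤ d by omega)
  have hL1 : (1 : ℝ) ≤ L := by have := hν'L; exact_mod_cast (show 1 ≤ L by omega)
  set C : ℝ := ((d : ℝ) - 1) * ((L : ℝ) - 1) with hC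
  have hC0 : 0 ≤ C := mul_nonneg (by linarith) (by linarith)
  set foot : ℝ := s * (1 + C * (2 * q₀ + s + 2 * τ)) with hfoot
  set σ : ℝ := 2 * γU * (C * s + s) + γE + γP * (2 * (C * s) + s) with hσ
  have hfoot0 : 0 ≤ foot := by positivity
  suffices H : ∀ N (k : Fin d → ℕ), crossLen k μ ν = N → (∀ κ, (k + Pi.single μ 1 : Fin d → ℕ) κ < L) →
      (k + Pi.single μ 1 : Fin d → ℕ) ν + 1 < L →
      ‖(defect U₀ U₁ z (site z (k + Pi.single μ 1)) ν : R) - defect U₀ U₁ z (site z k) ν‖ ≤ foot + (N : ℝ) * σ from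
    H _ k rfl hk' hν'L
  intro N
  induction N with
  | zero =>
      intro k hN hk' hν'L
      have hk : ∀ κ, k κ < L := fun κ => lt_of_le_of_lt (Nat.le_add_right _ _) (hk' κ)
      have htree := eq_zero_of_crossLen_eq_zero hN
      simp only [Nat.cast_zero, zero_mul, add_zero]
      rcases lt_or_ge (μ : ℕ) ν with hlt | hle
      · -- `μ < ν`: the offset is tree-like below `μ`; the difference is LOCAL (§2)
        have hkμ : IsTree k μ := fun κ hκ => htree κ hκ (hκ.trans hlt)
        have hneq : ν ≠ μ := fun h0 => by rw [h0] at hlt; exact lt_irrefl _ hlt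
        have hνL : k ν + 1 < L := by simpa [Pi.single_eq_of_ne hneq] using hν'L
        have hlad : (ladderLen k ν : ℝ) ≤ C := ladderLen_le hk ν
        calc _ ≤ s + (ladderLen k ν : ℝ) * s * (2 * q₀ + s + 2 * τ) :=
              norm_gradient_treeDir_le hU₀ hU₁ hs hq₀ hτ hs0 hkμ hlt hk' hνL
          _ ≤ s + C * s * (2 * q₀ + s + 2 * τ) := by
              have : 0 ≤ 2 * q₀ + s + 2 * τ := by positivity
              have := mul_le_mul_of_nonneg_right (mul_le_mul_of_nonneg_right hlad hs0) this
              linarith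
          _ = foot := by rw [hfoot]; ring
      · -- `ν ≤ μ`: both bonds are tree bonds; the difference VANISHES
        have hkν : IsTree k ν := fun κ hκ => htree κ (lt_of_lt_of_le hκ hle) hκ
        rw [gradient_eq_zero_of_isTree U₀ U₁ z hkν hle, norm_zero]
        exact hfoot0
  | succ N ih =>
      intro k hN hk' hν'L
      obtain ⟨h, hμ, hν⟩ := low_lt_of_crossLen_ne_zero (k := k) (μ := μ) (ν := ν) (by omega)
      have hneμ : low k h ≠ μ := fun h0 => by rw [h0] at hμ; exact lt_irrefl _ hμ
      have hneν : low k h ≠ ν := fun h0 => by rw [h0] at hν; exact lt_irrefl _ hν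
      -- offsets and their block bounds
      have hk : ∀ κ, k κ < L := fun κ => lt_of_le_of_lt (Nat.le_add_right _ _) (hk' κ)
      have hνL : k ν + 1 < L := lt_of_le_of_lt (Nat.add_le_add_right (Nat.le_add_right _ _) 1) hν'L
      have hpL : ∀ κ, pred' k h κ < L := fun κ => (pred'_le k h κ).trans_lt (hk κ)
      have hp' : ∀ κ, (pred' k h + Pi.single μ 1 : Fin d → ℕ) κ < L := fun κ =>
        lt_of_le_of_lt (Nat.add_le_add_right (pred'_le k h κ) _) (hk' κ)
      have hpν : pred' k h ν + 1 < L := lt_of_le_of_lt (Nat.add_le_add_right (pred'_le k h ν) 1) hνL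
      have hpν' : (pred' k h + Pi.single μ 1 : Fin d → ℕ) ν + 1 < L :=
        lt_of_le_of_lt (Nat.add_le_add_right (Nat.add_le_add_right (pred'_le k h ν) _) 1) hν'L
      have hpN : crossLen (pred' k h) μ ν = N := by have := crossLen_eq_succ k h hμ hν; omega
      -- the eight (+) corners, as sites
      have hx : site z (pred' k h) + e (low k h) = site z k := by rw [← site_add_single, pred'_add_single]
      have c1 : InBlock L z (site z (pred' k h)) := inBlock_of_lt z hpL
      have c2 : InBlock L z (site z (pred' k h) + e (low k h)) := by rw [hx]; exact inBlock_of_lt z hk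
      have c3 : InBlock L z (site z (pred' k h) + e ν) := by
        rw [← site_add_single]; exact inBlock_of_lt z (lt_of_add_single hpL hpν)
      have c4 : InBlock L z (site z (pred' k h) + e (low k h) + e ν) := by
        rw [hx, ← site_add_single]; exact inBlock_of_lt z (lt_of_add_single hk hνL)
      have c5 : InBlock L z (site z (pred' k h) + e μ) := by
        rw [← site_add_single]; exact inBlock_of_lt z hp'
      have c6 : InBlock L z (site z (pred' k h) + e μ + e (low k h)) := by
        rw [add_right_comm, hx, ← site_add_single]; exact inBlock_of_lt z hk'
      have c7 : InBlock L z (site z (pred' k h) + e μ + e ν) := by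
        rw [← site_add_single, ← site_add_single]; exact inBlock_of_lt z (lt_of_add_single hp' hpν')
      have c8 : InBlock L z (site z (pred' k h) + e μ + e (low k h) + e ν) := by
        rw [add_right_comm _ (e μ), hx, ← site_add_single, ← site_add_single]
        exact inBlock_of_lt z (lt_of_add_single hk' hν'L)
      -- the six sup inputs at the two parallel squares
      have h1 : ‖(U₀ (site z (pred' k h) + e μ) (low k h) : R) - U₀ (site z (pred' k h)) (low k h)‖ ≤ γU :=
        hγU _ _ c1 c2 c5 c6
      have h2 : ‖(defect U₀ U₁ z (site z (pred' k h) + e μ) ν : R) - 1‖ ≤ C * s := by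
        have := norm_defect_sub_one_le_ladderLen hU₀ hU₁ hs (pred' k h + Pi.single μ 1) hp' ν hpν'
        rw [site_add_single] at this
        exact this.trans (mul_le_mul_of_nonneg_right (ladderLen_le hp' ν) hs0)
      have h3 : ‖(plaq (gaugeAct (combGauge U₀ U₁ z) U₁) (site z (pred' k h) + e μ) (low k h) ν : R) -
          plaq U₀ (site z (pred' k h) + e μ) (low k h) ν‖ ≤ s := hs _ _ _ hneν c5 c6 c7 c8
      have h4 : ‖(plaq (gaugeAct (combGauge U₀ U₁ z) U₁) (site z (pred' k h)) (low k h) ν : R) -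
          plaq U₀ (site z (pred' k h)) (low k h) ν‖ ≤ s := hs _ _ _ hneν c1 c2 c3 c4
      have h5 := hγE _ _ _ hneν c1 c2 c3 c4 c5 c6 c7 c8
      have h6 := hγP _ _ _ hneν c1 c2 c3 c4 c5 c6 c7 c8
      have IH := ih (pred' k h) hpN hp' hpν'
      rw [site_add_single] at IH
      have hsrc : 2 * ‖(U₀ (site z (pred' k h) + e μ) (low k h) : R) - U₀ (site z (pred' k h)) (low k h)‖ *
            (‖(defect U₀ U₁ z (site z (pred' k h) + e μ) ν : R) - 1‖ +
              ‖(plaq (gaugeAct (combGauge U₀ U₁ z) U₁) (site z (pred' k h) + e μ) (low k h) ν : R) -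
                plaq U₀ (site z (pred' k h) + e μ) (low k h) ν‖) +
          ‖((plaq (gaugeAct (combGauge U₀ U₁ z) U₁) (site z (pred' k h) + e μ) (low k h) ν : R) -
              plaq U₀ (site z (pred' k h) + e μ) (low k h) ν) -
            ((plaq (gaugeAct (combGauge U₀ U₁ z) U₁) (site z (pred' k h)) (low k h) ν : R) -
              plaq U₀ (site z (pred' k h)) (low k h) ν)‖ +
          ‖(plaq U₀ (site z (pred' k h) + e μ) (low k h) ν : R) - plaq U₀ (site z (pred' k h)) (low k h) ν‖ *
            (2 * ‖(defect U₀ U₁ z (site z (pred' k h) + e μ) ν : R) - 1‖ +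
              ‖(plaq (gaugeAct (combGauge U₀ U₁ z) U₁) (site z (pred' k h)) (low k h) ν : R) -
                plaq U₀ (site z (pred' k h)) (low k h) ν‖) ≤ σ := by
        rw [hσ]
        refine add_le_add (add_le_add ?_ h5) ?_
        · exact mul_le_mul (mul_le_mul_of_nonneg_left h1 (by norm_num)) (add_le_add h2 h3) (by positivity)
            (by positivity)
        · exact mul_le_mul h6 (add_le_add (mul_le_mul_of_nonneg_left h2 (by norm_num)) h4) (by positivity) hγP0
      calc _ ≤ _ := norm_transverse_step_le hU₀ hU₁ z k h hμ hν
        _ ≤ (foot + (N : ℝ) * σ) + σ := add_le_add IH hsrc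
        _ = foot + ((N + 1 : ℕ) : ℝ) * σ := by push_cast; ring

/-- [folklore] **THE FIRST-DERIVATIVE SUP NORM OF THE COMB DEFECT ON A BLOCK** (the (O2a)-shape statement, sup of
first lattice differences; one block, unitary-like pairs).  For every interior bond `⟨x, x+e_ν⟩` of `B(z)` whose
`μ`-translate is interior too: `‖W⟨x+e_μ, ·+e_ν⟩ − W⟨x, ·+e_ν⟩‖ ≤ s·(1 + C(2q₀ + s + 2τ)) + C·(2γU(Cs + s) + γE +
γP(2Cs + s))`, `C = (d−1)(L−1)` — FIRST ORDER in (`s` + `C·γE` + `C·s·(γU, γP, q₀, τ)`-cross terms).  The DERIVATIVE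
INPUT `γE` (sup of the plain `μ`-gradient of the gauge-fixed deviation field over the block) is load-bearing and is NOT
implied by the sup data `s, q₀, τ`; every input is a hypothesis; nothing about Hölder quotients, covariant
derivatives in Bałaban's sense, patching across blocks, or the window is asserted. -/
theorem norm_gradient_le {U₀ U₁ : Cfg d R} {z : Site d} {L : ℕ} {μ ν : Fin d}
    {s q₀ τ γU γP γE : ℝ}
    (hU₀ : ∀ x ν, UnitaryLike (U₀ x ν)) (hU₁ : ∀ x ν, UnitaryLike (U₁ x ν))
    (hs : PlaqSup L z (fun y ρ ν =>
      ‖(plaq (gaugeAct (combGauge U₀ U₁ z) U₁) y ρ ν : R) - plaq U₀ y ρ ν‖) s)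
    (hq₀ : PlaqSup L z (fun y ρ ν => ‖(plaq U₀ y ρ ν : R) - 1‖) q₀)
    (hτ : ∀ x ρ, InBlock L z x → InBlock L z (x + e ρ) → ‖(U₀ x ρ : R) - 1‖ ≤ τ)
    (hγU : ∀ x ρ, InBlock L z x → InBlock L z (x + e ρ) → InBlock L z (x + e μ) → InBlock L z (x + e μ + e ρ) →
      ‖(U₀ (x + e μ) ρ : R) - U₀ x ρ‖ ≤ γU)
    (hγP : ∀ y ρ ν', ρ ≠ ν' → InBlock L z y → InBlock L z (y + e ρ) → InBlock L z (y + e ν') →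
      InBlock L z (y + e ρ + e ν') → InBlock L z (y + e μ) → InBlock L z (y + e μ + e ρ) →
      InBlock L z (y + e μ + e ν') → InBlock L z (y + e μ + e ρ + e ν') →
      ‖(plaq U₀ (y + e μ) ρ ν' : R) - plaq U₀ y ρ ν'‖ ≤ γP)
    (hγE : ∀ y ρ ν', ρ ≠ ν' → InBlock L z y → InBlock L z (y + e ρ) → InBlock L z (y + e ν') →
      InBlock L z (y + e ρ + e ν') → InBlock L z (y + e μ) → InBlock L z (y + e μ + e ρ) →
      InBlock L z (y + e μ + e ν') → InBlock L z (y + e μ + e ρ + e ν') →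
      ‖((plaq (gaugeAct (combGauge U₀ U₁ z) U₁) (y + e μ) ρ ν' : R) - plaq U₀ (y + e μ) ρ ν') -
          ((plaq (gaugeAct (combGauge U₀ U₁ z) U₁) y ρ ν' : R) - plaq U₀ y ρ ν')‖ ≤ γE)
    (hs0 : 0 ≤ s) (hq0 : 0 ≤ q₀) (hτ0 : 0 ≤ τ) (hγU0 : 0 ≤ γU) (hγP0 : 0 ≤ γP) (hγE0 : 0 ≤ γE)
    (x : Site d) (hx : InBlock L z x) (hxμ : InBlock L z (x + e μ)) (hxμν : InBlock L z (x + e μ + e ν)) :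
    ‖(defect U₀ U₁ z (x + e μ) ν : R) - defect U₀ U₁ z x ν‖ ≤
      s * (1 + ((d : ℝ) - 1) * ((L : ℝ) - 1) * (2 * q₀ + s + 2 * τ)) +
        ((d : ℝ) - 1) * ((L : ℝ) - 1) *
          (2 * γU * (((d : ℝ) - 1) * ((L : ℝ) - 1) * s + s) + γE +
            γP * (2 * (((d : ℝ) - 1) * ((L : ℝ) - 1) * s) + s)) := by
  obtain ⟨k, hk, rfl⟩ := exists_offset_of_inBlock hx
  have hk' : ∀ κ, (k + Pi.single μ 1 : Fin d → ℕ) κ < L := by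
    rw [← site_add_single, inBlock_site_iff] at hxμ; exact hxμ
  have hν'L : (k + Pi.single μ 1 : Fin d → ℕ) ν + 1 < L := by
    rw [← site_add_single, ← site_add_single, inBlock_site_iff] at hxμν
    have := hxμν ν
    simpa [Pi.single_eq_same, ← add_assoc] using this
  have H := norm_transverse_diff_le hU₀ hU₁ hs hq₀ hτ hγU hγP hγE hs0 hq0 hτ0 hγU0 hγP0 k hk' hν'L
  rw [site_add_single] at H
  refine H.trans (add_le_add le_rfl (mul_le_mul_of_nonneg_right ?_ (by
    have hd1 : (1 : ℝ) ≤ d := by have := μ.isLt; exact_mod_cast (show 1 ≤ d by omega)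
    have hL1 : (1 : ℝ) ≤ L := by have := hk' μ; exact_mod_cast (show 1 ≤ L by omega)
    have hC0 : 0 ≤ ((d : ℝ) - 1) * ((L : ℝ) - 1) := mul_nonneg (by linarith) (by linarith)
    positivity)))
  calc (crossLen k μ ν : ℝ) ≤ (ladderLen k ν : ℝ) := by exact_mod_cast crossLen_le_ladderLen k μ ν
    _ ≤ _ := ladderLen_le hk ν

end Across

/-! ## §4  [arith] Lattice Hölder interpolation along a path: `β`-quotients from (sup, first difference)

The `β`-Hölder entry of a window (the format of the third member of (1.36) / (3.31) / (3.32), there for the FIRST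
covariant derivative, i.e. a `C^{1,β}` norm) is, on a lattice, interpolated from a sup bound and a first-difference
bound of the SAME field along lattice paths: `min(2A, m·B) ≤ (2A)^{1−β}·(m·B)^β`.  Typed once, generically; applied
to `f = W − 1` along any lattice path in a block it turns `T4RelativeComb.norm_defect_sub_one_le_ladderLen` (sup)
and §2–§3 (first differences) into the `C^{0,β}` quotient of the comb defect.  The `C^{1,β}` quotient of the
printed norm `‖·‖_{1,β}` would need SECOND differences of `W` in all pairs of directions — along a tooth these are
`T4RelativeLadder.norm_defect_second_diff_le`; ACROSS teeth they are NOT treated anywhere in the tree (located, not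
claimed). -/

section Holder

variable {M : Type*} [SeminormedAddCommGroup M]

/-- [folklore] (arith) `min a b ≤ a^{1−β}·b^β` for `0 ≤ a, b`, `0 ≤ β ≤ 1`. -/
theorem min_le_rpow_mul_rpow {a b β : ℝ} (ha : 0 ≤ a) (hb : 0 ≤ b) (hβ0 : 0 ≤ β) (hβ1 : β ≤ 1) :
    min a b ≤ a ^ (1 - β) * b ^ β := by
  have hm0 : 0 ≤ min a b := le_min ha hb
  have hexp : (1 - β) + β = 1 := by ring
  calc min a b = (min a b) ^ ((1 - β) + β) := by rw [hexp, Real.rpow_one]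
    _ = (min a b) ^ (1 - β) * (min a b) ^ β := Real.rpow_add' hm0 (by rw [hexp]; norm_num)
    _ ≤ a ^ (1 - β) * b ^ β :=
        mul_le_mul (Real.rpow_le_rpow hm0 (min_le_left a b) (by linarith))
          (Real.rpow_le_rpow hm0 (min_le_right a b) hβ0) (Real.rpow_nonneg hm0 _) (Real.rpow_nonneg ha _)

/-- [folklore] (arith) HÖLDER INCREMENTS FROM (SUP, FIRST DIFFERENCE) along a path `f : ℕ → M`: `‖f i‖ ≤ A` and
`‖f(i+1) − f(i)‖ ≤ B` for all `i` give `‖f(x+m) − f(x)‖ ≤ (2A)^{1−β}·B^β·m^β` (`0 ≤ β ≤ 1`). -/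
theorem norm_sub_le_holder (f : ℕ → M) {A B β : ℝ} (hA : ∀ i, ‖f i‖ ≤ A) (hB : ∀ i, ‖f (i + 1) - f i‖ ≤ B)
    (hβ0 : 0 ≤ β) (hβ1 : β ≤ 1) (x m : ℕ) :
    ‖f (x + m) - f x‖ ≤ (2 * A) ^ (1 - β) * B ^ β * (m : ℝ) ^ β := by
  have hA0 : 0 ≤ A := (norm_nonneg _).trans (hA 0)
  have hB0 : 0 ≤ B := (norm_nonneg _).trans (hB 0)
  have h1 : ‖f (x + m) - f x‖ ≤ 2 * A := (norm_sub_le _ _).trans (by linarith [hA (x + m), hA x])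
  have h2 : ‖f (x + m) - f x‖ ≤ (m : ℝ) * B := norm_shift_sub_le f hB x m
  calc ‖f (x + m) - f x‖ ≤ min (2 * A) ((m : ℝ) * B) := le_min h1 h2
    _ ≤ (2 * A) ^ (1 - β) * ((m : ℝ) * B) ^ β := min_le_rpow_mul_rpow (by linarith) (by positivity) hβ0 hβ1
    _ = (2 * A) ^ (1 - β) * B ^ β * (m : ℝ) ^ β := by
        rw [Real.mul_rpow (by positivity) hB0]; ring

end Holder

/-! ## §5  Non-vacuity: the flat pair inhabits every hypothesis with all constants `0`, and the bound is then `0` -/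

section Toy

/-- [folklore] The comb gauge of a pair with `U₁ = U₀` is trivial. -/
theorem combGauge_self {d : ℕ} {R : Type*} [NormedRing R] (U : Cfg d R) (z x : Site d) :
    combGauge U U z x = 1 := by
  show relGauge U U z _ = 1
  simp [relGauge]

/-- Non-vacuity of `norm_gradient_le`: for the flat pair `U₀ = U₁ ≡ 1` over `ℝ` every hypothesis holds with
`s = q₀ = τ = γU = γP = γE = 0` and the conclusion reads `‖W(x+e_μ) − W(x)‖ ≤ 0`. -/
example {d L : ℕ} (z x : Site d) (μ ν : Fin d) (hx : InBlock L z x) (hxμ : InBlock L z (x + e μ))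
    (hxμν : InBlock L z (x + e μ + e ν)) :
    ‖(defect (fun _ _ => (1 : ℝˣ)) (fun _ _ => 1) z (x + e μ) ν : ℝ) -
        defect (fun _ _ => (1 : ℝˣ)) (fun _ _ => 1) z x ν‖ ≤ 0 := by
  have hg : combGauge (fun _ _ => (1 : ℝˣ)) (fun _ _ => (1 : ℝˣ)) z = fun _ => 1 :=
    funext fun y => combGauge_self (d := d) (fun _ _ => (1 : ℝˣ)) z y
  have h1 : UnitaryLike (1 : ℝˣ) := UnitaryLike.one
  have H := norm_gradient_le (R := ℝ) (U₀ := fun _ _ => (1 : ℝˣ)) (U₁ := fun _ _ => (1 : ℝˣ)) (z := z) (L := L)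
    (μ := μ) (ν := ν) (s := 0) (q₀ := 0) (τ := 0) (γU := 0) (γP := 0) (γE := 0)
    (fun _ _ => h1) (fun _ _ => h1)
    (by intro y ρ ν' _ _ _ _ _; simp [hg, gaugeAct, plaq])
    (by intro y ρ ν' _ _ _ _ _; simp [plaq])
    (by intro y ρ _ _; simp) (by intro y ρ _ _ _ _; simp)
    (by intro y ρ ν' _ _ _ _ _ _ _ _ _; simp [plaq])
    (by intro y ρ ν' _ _ _ _ _ _ _ _ _; simp [hg, gaugeAct, plaq])
    le_rfl le_rfl le_rfl le_rfl le_rfl le_rfl x hx hxμ hxμν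
  simpa using H

end Toy

/-! ## §6  (v1.1) DISCHARGING THE DEVIATION-GRADIENT INPUT `γE` FROM RAW DATA — bookkeeping after all

The located residual (R1) of GAPS G-pv24g10-1 asked for a bound on the plain `μ`-gradient of the GAUGE-FIXED
deviation field `E(y) = plaq(U₁^g)(y) − plaq U₀(y) = g(y)·plaq U₁(y)·g(y)⁻¹ − plaq U₀(y)` (`plaq_gaugeAct`) from RAW
data of the pair, and recorded it as "not bookkeeping (needs the gradient of the comb gauge across non-tree
directions)".  CORRECTION (this section): the comb gauge's own one-bond variation is controlled by the DEFINITION of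
the defect rearranged — the RE-COMBING IDENTITY `g(x+e_μ) = U₀⟨x,x+e_μ⟩⁻¹ · W⟨x,x+e_μ⟩⁻¹ · g(x) · U₁⟨x,x+e_μ⟩`
(`combGauge_step`; on a tree bond `W = 1`) — hence `‖g(x+e_μ) − g(x)‖ ≤ ‖U₀ − 1‖ + ‖W⟨x,x+e_μ⟩ − 1‖ + ‖U₁ − 1‖ ≤
τ₀ + C·s + τ₁` by the master sup count, and `‖E(y+e_μ) − E(y)‖ ≤ γ₁ + γ₀ + 2‖plaq U₁(y) − 1‖·‖g(y+e_μ) − g(y)‖`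
(`norm_conjDev_sub_conjDev_le`), i.e. the `hγE` hypothesis of `norm_gradient_le` is DISCHARGED with
`γE := γ₁ + γ₀ + 2q₁(τ₀ + τ₁ + C·s)` from block sups of: the RAW plaquette gradients `γ₁` (of `U₁`), `γ₀` (of `U₀`),
the raw curvature `q₁` of `U₁`, the bond deviations `τ₀, τ₁`, and the gauge-fixed sup `s` (itself discharged from raw
data by `T4RelativeComb.plaqSup_fine` / `plaqSup_crude`) — `deviation_gradient_le`; plugged in: `norm_gradient_le_raw`.
READING (honest): the discharged `γE` is `γ₁ + γ₀ +` (curvature × bond deviation) `+` (curvature × `C·s`); whether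
this beats the crude `2·C·s` depends on the regime (it does when raw plaquette GRADIENTS and curvature × deviation
products are small against the deviation sup `s` — the format of windows whose gradient entries carry an extra power
of `(L^jη)^{−1}`); no regime claim is made.  What remains of G-pv24g10-1: (R2) second differences across teeth, (R3) the
`‖·‖_{1,β}` window-norm definition + consumer instantiation — unchanged. -/

section Discharge

variable [NormOneClass R]

omit [NormOneClass R] in
/-- [folklore] Two conjugates of near-identity elements minus two backgrounds: `‖(g′P₁′g′⁻¹ − P₀′) − (gP₁g⁻¹ − P₀)‖ ≤
‖P₁′ − P₁‖ + 2‖g′ − g‖·‖P₁ − 1‖ + ‖P₀′ − P₀‖` for unitary-like `g, g′`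
(`g′P₁′g′⁻¹ − gP₁g⁻¹ = g′(P₁′ − P₁)g′⁻¹ + [g′(P₁ − 1)g′⁻¹ − g(P₁ − 1)g⁻¹]`, the bracket by
`T4RelativeLadder.norm_conj_sub_conj_le` applied to `g′⁻¹, g⁻¹` and `‖g′⁻¹ − g⁻¹‖ ≤ ‖g′ − g‖`). -/
theorem norm_conjDev_sub_conjDev_le {g g' : Rˣ} (hg : UnitaryLike g) (hg' : UnitaryLike g') (P₁ P₁' P₀ P₀' : R) :
    ‖((g' : R) * P₁' * ↑g'⁻¹ - P₀') - ((g : R) * P₁ * ↑g⁻¹ - P₀)‖ ≤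
      ‖P₁' - P₁‖ + 2 * ‖(g' : R) - g‖ * ‖P₁ - 1‖ + ‖P₀' - P₀‖ := by
  have e : ((g' : R) * P₁' * ↑g'⁻¹ - P₀') - ((g : R) * P₁ * ↑g⁻¹ - P₀) =
      (g' : R) * (P₁' - P₁) * ↑g'⁻¹ +
        ((((g'⁻¹)⁻¹ : Rˣ) : R) * (P₁ - 1) * ↑g'⁻¹ - (((g⁻¹)⁻¹ : Rˣ) : R) * (P₁ - 1) * ↑g⁻¹) - (P₀' - P₀) := by
    simp only [inv_inv, mul_sub, sub_mul, mul_one, Units.mul_inv]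
    abel
  rw [e]
  have h1 : ‖(g' : R) * (P₁' - P₁) * ↑g'⁻¹‖ ≤ ‖P₁' - P₁‖ :=
    (norm_mul_unit_le hg'.inv _).trans (norm_unit_mul_le hg' _)
  have h2 : ‖(((g'⁻¹)⁻¹ : Rˣ) : R) * (P₁ - 1) * ↑g'⁻¹ - (((g⁻¹)⁻¹ : Rˣ) : R) * (P₁ - 1) * ↑g⁻¹‖ ≤
      2 * ‖(g' : R) - g‖ * ‖P₁ - 1‖ := by
    have := norm_conj_sub_conj_le hg'.inv hg.inv (P₁ - 1)
    refine this.trans ?_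
    have hinv : ‖((g'⁻¹ : Rˣ) : R) - ↑g⁻¹‖ ≤ ‖(g' : R) - g‖ := norm_inv_sub_inv_le hg' hg
    exact mul_le_mul_of_nonneg_right (mul_le_mul_of_nonneg_left hinv (by norm_num)) (norm_nonneg _)
  calc _ ≤ ‖(g' : R) * (P₁' - P₁) * ↑g'⁻¹ +
          ((((g'⁻¹)⁻¹ : Rˣ) : R) * (P₁ - 1) * ↑g'⁻¹ - (((g⁻¹)⁻¹ : Rˣ) : R) * (P₁ - 1) * ↑g⁻¹)‖ + ‖P₀' - P₀‖ :=
        norm_sub_le _ _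
    _ ≤ ‖(g' : R) * (P₁' - P₁) * ↑g'⁻¹‖ +
          ‖(((g'⁻¹)⁻¹ : Rˣ) : R) * (P₁ - 1) * ↑g'⁻¹ - (((g⁻¹)⁻¹ : Rˣ) : R) * (P₁ - 1) * ↑g⁻¹‖ + ‖P₀' - P₀‖ :=
        add_le_add (norm_add_le _ _) le_rfl
    _ ≤ _ := by linarith

omit [NormOneClass R] in
/-- [folklore] THE RE-COMBING IDENTITY (the definition of the defect, rearranged): across ANY bond `⟨x, x+e_μ⟩`,
`g(x+e_μ) = U₀⟨x,x+e_μ⟩⁻¹ · W⟨x,x+e_μ⟩⁻¹ · g(x) · U₁⟨x,x+e_μ⟩` for the comb gauge `g` and defect `W` of the pair;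
on a tree bond `W = 1` (`T4RelativeComb.defect_tree`) and this is the relative step. -/
theorem combGauge_step (U₀ U₁ : Cfg d R) (z x : Site d) (μ : Fin d) :
    combGauge U₀ U₁ z (x + e μ) =
      (U₀ x μ)⁻¹ * (defect U₀ U₁ z x μ)⁻¹ * combGauge U₀ U₁ z x * U₁ x μ := by
  simp only [defect, gaugeAct, mul_inv_rev, inv_inv]
  group

/-- [folklore] ONE-BOND VARIATION OF THE COMB GAUGE: `‖g(x+e_μ) − g(x)‖ ≤ ‖U₀⟨x,x+e_μ⟩ − 1‖ + ‖W⟨x,x+e_μ⟩ − 1‖ +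
‖U₁⟨x,x+e_μ⟩ − 1‖` for unitary-like pairs (`combGauge_step` + `g′ − g = (U₀⁻¹ − 1)W⁻¹gU₁ + (W⁻¹ − 1)gU₁ +
g(U₁ − 1)` + `‖u⁻¹ − 1‖ ≤ ‖u − 1‖`). -/
theorem norm_combGauge_step_sub_le {U₀ U₁ : Cfg d R} (hU₀ : ∀ x ν, UnitaryLike (U₀ x ν))
    (hU₁ : ∀ x ν, UnitaryLike (U₁ x ν)) (z x : Site d) (μ : Fin d) :
    ‖(combGauge U₀ U₁ z (x + e μ) : R) - combGauge U₀ U₁ z x‖ ≤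
      ‖(U₀ x μ : R) - 1‖ + ‖(defect U₀ U₁ z x μ : R) - 1‖ + ‖(U₁ x μ : R) - 1‖ := by
  have hg := unitaryLike_combGauge hU₀ hU₁ z
  have hW := unitaryLike_defect hU₀ hU₁ z x μ
  set g : Rˣ := combGauge U₀ U₁ z x with hgdef
  set W : Rˣ := defect U₀ U₁ z x μ with hWdef
  set u₀ : Rˣ := U₀ x μ
  set u₁ : Rˣ := U₁ x μ
  rw [combGauge_step U₀ U₁ z x μ]
  have e : (((u₀⁻¹ * W⁻¹ * g * u₁ : Rˣ)) : R) - (g : R) =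
      (((u₀⁻¹ : Rˣ) : R) - 1) * (((W⁻¹ : Rˣ) : R) * g * u₁) + (((W⁻¹ : Rˣ) : R) - 1) * ((g : R) * u₁) +
        (g : R) * ((u₁ : R) - 1) := by
    push_cast; noncomm_ring
  rw [e]
  have hWgu : ‖((W⁻¹ : Rˣ) : R) * g * u₁‖ ≤ 1 := by
    have := (hW.inv.mul (hg x)).mul (hU₁ x μ)
    simpa [Units.val_mul, mul_assoc] using this.1
  have hgu : ‖(g : R) * u₁‖ ≤ 1 := by
    have := (hg x).mul (hU₁ x μ); simpa [Units.val_mul] using this.1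
  calc _ ≤ ‖(((u₀⁻¹ : Rˣ) : R) - 1) * (((W⁻¹ : Rˣ) : R) * g * u₁)‖ + ‖(((W⁻¹ : Rˣ) : R) - 1) * ((g : R) * u₁)‖ +
          ‖(g : R) * ((u₁ : R) - 1)‖ := norm_add₃_le
    _ ≤ ‖((u₀⁻¹ : Rˣ) : R) - 1‖ * 1 + ‖((W⁻¹ : Rˣ) : R) - 1‖ * 1 + ‖(u₁ : R) - 1‖ := by
        refine add_le_add (add_le_add ?_ ?_) (norm_unit_mul_le (hg x) _)
        · exact (norm_mul_le _ _).trans (mul_le_mul_of_nonneg_left hWgu (norm_nonneg _))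
        · exact (norm_mul_le _ _).trans (mul_le_mul_of_nonneg_left hgu (norm_nonneg _))
    _ ≤ _ := by
        rw [mul_one, mul_one]
        exact add_le_add (add_le_add (norm_inv_sub_one_le (hU₀ x μ)) (norm_inv_sub_one_le hW)) le_rfl

/-- [folklore] **THE DEVIATION-GRADIENT INPUT DISCHARGED FROM RAW DATA.**  On the block `B(z)`, for a unitary-like
pair: the plain `μ`-gradient of the gauge-fixed deviation field `E = plaq(U₁^g) − plaq U₀` over squares whose eight
(+`e_μ`) corners lie in the block is `≤ γ₁ + γ₀ + 2q₁(τ₀ + C·s + τ₁)`, `C = (d−1)(L−1)`, from block sups of the RAW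
plaquette gradients `γ₁` (`U₁`), `γ₀` (`U₀`), the raw curvature `q₁` of `U₁`, the bond deviations `τ₀`, `τ₁`, and the
gauge-fixed deviation sup `s` — exactly the `hγE` hypothesis of `norm_gradient_le`. -/
theorem deviation_gradient_le {U₀ U₁ : Cfg d R} {z : Site d} {L : ℕ} {μ : Fin d} {s q₁ τ₀ τ₁ γ₀ γ₁ : ℝ}
    (hU₀ : ∀ x ν, UnitaryLike (U₀ x ν)) (hU₁ : ∀ x ν, UnitaryLike (U₁ x ν))
    (hs : PlaqSup L z (fun y ρ ν =>
      ‖(plaq (gaugeAct (combGauge U₀ U₁ z) U₁) y ρ ν : R) - plaq U₀ y ρ ν‖) s)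
    (hq₁ : PlaqSup L z (fun y ρ ν => ‖(plaq U₁ y ρ ν : R) - 1‖) q₁)
    (hτ₀ : ∀ x ρ, InBlock L z x → InBlock L z (x + e ρ) → ‖(U₀ x ρ : R) - 1‖ ≤ τ₀)
    (hτ₁ : ∀ x ρ, InBlock L z x → InBlock L z (x + e ρ) → ‖(U₁ x ρ : R) - 1‖ ≤ τ₁)
    (hγ₀ : ∀ y ρ ν', ρ ≠ ν' → InBlock L z y → InBlock L z (y + e ρ) → InBlock L z (y + e ν') →
      InBlock L z (y + e ρ + e ν') → InBlock L z (y + e μ) → InBlock L z (y + e μ + e ρ) →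
      InBlock L z (y + e μ + e ν') → InBlock L z (y + e μ + e ρ + e ν') →
      ‖(plaq U₀ (y + e μ) ρ ν' : R) - plaq U₀ y ρ ν'‖ ≤ γ₀)
    (hγ₁ : ∀ y ρ ν', ρ ≠ ν' → InBlock L z y → InBlock L z (y + e ρ) → InBlock L z (y + e ν') →
      InBlock L z (y + e ρ + e ν') → InBlock L z (y + e μ) → InBlock L z (y + e μ + e ρ) →
      InBlock L z (y + e μ + e ν') → InBlock L z (y + e μ + e ρ + e ν') →
      ‖(plaq U₁ (y + e μ) ρ ν' : R) - plaq U₁ y ρ ν'‖ ≤ γ₁)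
    (hs0 : 0 ≤ s) :
    ∀ y ρ ν', ρ ≠ ν' → InBlock L z y → InBlock L z (y + e ρ) → InBlock L z (y + e ν') →
      InBlock L z (y + e ρ + e ν') → InBlock L z (y + e μ) → InBlock L z (y + e μ + e ρ) →
      InBlock L z (y + e μ + e ν') → InBlock L z (y + e μ + e ρ + e ν') →
      ‖((plaq (gaugeAct (combGauge U₀ U₁ z) U₁) (y + e μ) ρ ν' : R) - plaq U₀ (y + e μ) ρ ν') -
          ((plaq (gaugeAct (combGauge U₀ U₁ z) U₁) y ρ ν' : R) - plaq U₀ y ρ ν')‖ ≤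
        γ₁ + γ₀ + 2 * q₁ * (τ₀ + ((d : ℝ) - 1) * ((L : ℝ) - 1) * s + τ₁) := by
  intro y ρ ν' hne c1 c2 c3 c4 c5 c6 c7 c8
  have hg := unitaryLike_combGauge hU₀ hU₁ z
  rw [plaq_gaugeAct, plaq_gaugeAct]
  push_cast
  have H := norm_conjDev_sub_conjDev_le (hg y) (hg (y + e μ)) (plaq U₁ y ρ ν' : R)
    (plaq U₁ (y + e μ) ρ ν' : R) (plaq U₀ y ρ ν' : R) (plaq U₀ (y + e μ) ρ ν' : R)
  refine H.trans ?_
  have h1 := hγ₁ y ρ ν' hne c1 c2 c3 c4 c5 c6 c7 c8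
  have h0 := hγ₀ y ρ ν' hne c1 c2 c3 c4 c5 c6 c7 c8
  have hP : ‖(plaq U₁ y ρ ν' : R) - 1‖ ≤ q₁ := hq₁ y ρ ν' hne c1 c2 c3 c4
  -- the comb gauge's one-bond variation across `⟨y, y+e_μ⟩`, through the re-combing identity and the sup count
  obtain ⟨k, hk, rfl⟩ := exists_offset_of_inBlock c1
  have hk' : ∀ κ, (k + Pi.single μ 1 : Fin d → ℕ) κ < L := by
    rw [← site_add_single, inBlock_site_iff] at c5; exact c5
  have hkμ : k μ + 1 < L := by simpa using hk' μ
  have hW : ‖(defect U₀ U₁ z (site z k) μ : R) - 1‖ ≤ ((d : ℝ) - 1) * ((L : ℝ) - 1) * s :=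
    (norm_defect_sub_one_le_ladderLen hU₀ hU₁ hs k hk μ hkμ).trans
      (mul_le_mul_of_nonneg_right (ladderLen_le hk μ) hs0)
  have hgg : ‖(combGauge U₀ U₁ z (site z k + e μ) : R) - combGauge U₀ U₁ z (site z k)‖ ≤
      τ₀ + ((d : ℝ) - 1) * ((L : ℝ) - 1) * s + τ₁ :=
    (norm_combGauge_step_sub_le hU₀ hU₁ z (site z k) μ).trans
      (add_le_add (add_le_add (hτ₀ _ _ c1 c5) hW) (hτ₁ _ _ c1 c5))
  have hgg0 : 0 ≤ τ₀ + ((d : ℝ) - 1) * ((L : ℝ) - 1) * s + τ₁ := (norm_nonneg _).trans hgg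
  have : 2 * ‖(combGauge U₀ U₁ z (site z k + e μ) : R) - combGauge U₀ U₁ z (site z k)‖ *
      ‖(plaq U₁ (site z k) ρ ν' : R) - 1‖ ≤ 2 * (τ₀ + ((d : ℝ) - 1) * ((L : ℝ) - 1) * s + τ₁) * q₁ :=
    mul_le_mul (mul_le_mul_of_nonneg_left hgg (by norm_num)) hP (norm_nonneg _) (by linarith [hgg0])
  linarith

/-- [folklore] `norm_gradient_le` WITH THE DEVIATION-GRADIENT INPUT DISCHARGED (`deviation_gradient_le`): the first
lattice difference of the comb defect on interior bonds of one block, from block sups of the gauge-fixed deviation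
`s`, the two curvatures `q₀, q₁`, the bond deviations `τ₀, τ₁`, the base bond gradient `γU` and the two RAW plaquette
gradients `γ₀, γ₁` — `γE := γ₁ + γ₀ + 2q₁(τ₀ + C·s + τ₁)`. -/
theorem norm_gradient_le_raw {U₀ U₁ : Cfg d R} {z : Site d} {L : ℕ} {μ ν : Fin d}
    {s q₀ q₁ τ₀ τ₁ γU γ₀ γ₁ : ℝ}
    (hU₀ : ∀ x ν, UnitaryLike (U₀ x ν)) (hU₁ : ∀ x ν, UnitaryLike (U₁ x ν))
    (hs : PlaqSup L z (fun y ρ ν =>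
      ‖(plaq (gaugeAct (combGauge U₀ U₁ z) U₁) y ρ ν : R) - plaq U₀ y ρ ν‖) s)
    (hq₀ : PlaqSup L z (fun y ρ ν => ‖(plaq U₀ y ρ ν : R) - 1‖) q₀)
    (hq₁ : PlaqSup L z (fun y ρ ν => ‖(plaq U₁ y ρ ν : R) - 1‖) q₁)
    (hτ₀ : ∀ x ρ, InBlock L z x → InBlock L z (x + e ρ) → ‖(U₀ x ρ : R) - 1‖ ≤ τ₀)
    (hτ₁ : ∀ x ρ, InBlock L z x → InBlock L z (x + e ρ) → ‖(U₁ x ρ : R) - 1‖ ≤ τ₁)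
    (hγU : ∀ x ρ, InBlock L z x → InBlock L z (x + e ρ) → InBlock L z (x + e μ) → InBlock L z (x + e μ + e ρ) →
      ‖(U₀ (x + e μ) ρ : R) - U₀ x ρ‖ ≤ γU)
    (hγ₀ : ∀ y ρ ν', ρ ≠ ν' → InBlock L z y → InBlock L z (y + e ρ) → InBlock L z (y + e ν') →
      InBlock L z (y + e ρ + e ν') → InBlock L z (y + e μ) → InBlock L z (y + e μ + e ρ) →
      InBlock L z (y + e μ + e ν') → InBlock L z (y + e μ + e ρ + e ν') →
      ‖(plaq U₀ (y + e μ) ρ ν' : R) - plaq U₀ y ρ ν'‖ ≤ γ₀)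
    (hγ₁ : ∀ y ρ ν', ρ ≠ ν' → InBlock L z y → InBlock L z (y + e ρ) → InBlock L z (y + e ν') →
      InBlock L z (y + e ρ + e ν') → InBlock L z (y + e μ) → InBlock L z (y + e μ + e ρ) →
      InBlock L z (y + e μ + e ν') → InBlock L z (y + e μ + e ρ + e ν') →
      ‖(plaq U₁ (y + e μ) ρ ν' : R) - plaq U₁ y ρ ν'‖ ≤ γ₁)
    (hs0 : 0 ≤ s) (hq0 : 0 ≤ q₀) (hq1 : 0 ≤ q₁) (hτ0 : 0 ≤ τ₀) (hτ1 : 0 ≤ τ₁) (hγU0 : 0 ≤ γU)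
    (hγ00 : 0 ≤ γ₀) (hγ10 : 0 ≤ γ₁)
    (x : Site d) (hx : InBlock L z x) (hxμ : InBlock L z (x + e μ)) (hxμν : InBlock L z (x + e μ + e ν)) :
    ‖(defect U₀ U₁ z (x + e μ) ν : R) - defect U₀ U₁ z x ν‖ ≤
      s * (1 + ((d : ℝ) - 1) * ((L : ℝ) - 1) * (2 * q₀ + s + 2 * τ₀)) +
        ((d : ℝ) - 1) * ((L : ℝ) - 1) *
          (2 * γU * (((d : ℝ) - 1) * ((L : ℝ) - 1) * s + s) +
            (γ₁ + γ₀ + 2 * q₁ * (τ₀ + ((d : ℝ) - 1) * ((L : ℝ) - 1) * s + τ₁)) +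
            γ₀ * (2 * (((d : ℝ) - 1) * ((L : ℝ) - 1) * s) + s)) := by
  have hd1 : (1 : ℝ) ≤ d := by have := μ.isLt; exact_mod_cast (show 1 ≤ d by omega)
  have hL1 : (1 : ℝ) ≤ L := by
    obtain ⟨k, hk, -⟩ := exists_offset_of_inBlock hx
    have := hk μ; exact_mod_cast (show 1 ≤ L by omega)
  have hC0 : 0 ≤ ((d : ℝ) - 1) * ((L : ℝ) - 1) := mul_nonneg (by linarith) (by linarith)
  exact norm_gradient_le hU₀ hU₁ hs hq₀ hτ₀ hγU hγ₀
    (deviation_gradient_le hU₀ hU₁ hs hq₁ hτ₀ hτ₁ hγ₀ hγ₁ hs0) hs0 hq0 hτ0 hγU0 hγ00 (by positivity)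
    x hx hxμ hxμν

end Discharge

end Literature.MathematicalPhysics.QuantumFieldTheory.Balaban1983to89.T4RelativeCombGradient
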